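import Literature.MathematicalPhysics.QuantumLattice.InfVolFermionStateHubbardEnergy
import Literature.MathematicalPhysics.QuantumLattice.HubbardNNNHoppingClusterEmbedding
import Literature.MathematicalPhysics.QuantumLattice.BootstrapCertificateDuality
import Literature.MathematicalPhysics.QuantumLattice.HubbardChainEnergyDensity
import Literature.MathematicalPhysics.QuantumLattice.HubbardEnergyDensityCertificateLimit
import HarnessLib

/-!
# Anderson's WEIGHTED open-cluster lower bound for the Hubbard torus, chain and square lattice
# (the by-name soundness theorems of the `anderson_*` certificate rows)

Anderson's cluster decomposition `H = Σ_clusters h` gives `E₀(H) ≥ Σ_clusters E₀(h)` (Anderson 1951, eq. (2));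
with WEIGHTED open clusters (Valentí–Stolze–Hirschfeld 1991, §II) the cluster floors may come from any certified
operator inequality `h ⪰ m·1` on the cluster Fock space. This file proves the OPERATOR INEQUALITY ⇒ ENERGY BOUND
step for the Hubbard torus `(ℤ/Lℤ)^d`, the chain and the square lattice in the thermodynamic limit; it does NOT
check any cluster certificate (the positive-semidefiniteness hypothesis `hq` below is what a certificate asserts).
Provenance: written by the pub-mbboot cell (SDP lane A, `anderson_*` certificate rows of the sr-mbsolver venture;
staged bytes sha256 8d111149…), filed under `Literature/` next to its uniform-weight sibling
`HubbardNNNHoppingClusterLowerBound.lean` (cell PLACEMENT rule: soundness theorems of published methods live in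
Literature; certificate claim nodes live under the cell topic). [cite: Anderson1951, eq. (2)]
[cite: ValentiStolzeHirschfeld1991, §II]

## Mathematics (Anderson 1951, eq. (2); weighted clusters: Valentí–Stolze–Hirschfeld 1991, §II)

Let `Λ' ⊆ ℤ^d` be a finite window and
`h = -t Σ_{x, x+eᵢ ∈ Λ'} J(x,i) K_{x,i} + U Σ_{x ∈ Λ'} V(x) n_{x↑} n_{x↓} + Σ_{x ∈ Λ'} μ(x) n_x ∈ 𝔄(Λ')`
(`clusterHamiltonian Λ' t U J V μ`; `K_{x,i} = Σ_σ (a†_{xσ} a_{x+eᵢ,σ} + h.c.)` = `clusterBondKinetic`) a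
weighted open cluster. Placing `Λ'` in the torus `(ℤ/Lℤ)^d` (`PolySite.toTorusEmb`, injective as soon as
`x ↦ x mod L` is injective on `Λ'`) and summing the Jordan–Wigner-free embeddings `Γ` (`fermionEmbed`) over
all `L^d` translates counts every torus bond of direction `i` with total weight `Σ_x J(x,i)`
(`bondWeightSum Λ' J i`), every doubly occupied site with weight `Σ_x V(x)` (`siteWeightSum Λ' V`) and `N̂`
with weight `Σ_x μ(x)` (`sum_relabel_translate_clusterHamiltonian`, from
`hubbardTorus_eq_sum_torusBondKinetic`, `L ≥ 3`). Hence, for a finite family of clusters `k` whose bond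
weights add up to `1` in every direction and whose interaction weights add up to `1`, certified floors
`h_k ⪰ m_k` on the full cluster Fock spaces give, in every particle-number sector `N ≤ 2L^d`,

  `L^d Σ_k m_k - (Σ_k Σ_x μ_k(x)) · N ≤ E₀(H_{(ℤ/Lℤ)^d}(t,U), N)`   (`groundEnergyAt_torus_ge_of_clusterFamily`),

by `Σ_k Σ_v T_v Γ(h_k - m_k) = H + (Σμ) N̂ - L^d (Σ m) ⪰ 0` and `le_groundEnergy_of_posSemidef_sub_sector`.
Dividing by `L^d` and passing to the limit gives the thermodynamic-limit forms for the chain at half filling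
(`hubbardChainEnergyDensity`, `hubbardChainEnergyDensity_ge_of_forall_ge`) and for the square lattice at
density `n ∈ [0,2)` (`energyDensity2D`, `energyDensity2D_ge_of_eventually_ge_torus`).

## The certificate rows' normal form (§5) and the row dictionary (§7, §9)

The lane's tool certifies `h(w,v) = -t Σ_bonds w K + (U/2) Σ_sites v [n_x ≠ 1] ⪰ q` with
`[n_x ≠ 1] = 2 n↑n↓ - n_x + 1` (`andersonCluster Λ' t U w v`), `Σ w = 1` per lattice direction
(two-orientation families: total `2`) and `Σ v = 1`; `andersonCluster_eq` is the identity
`h(w,v) = clusterHamiltonian(J = w, V = v, μ = -(U/2)v) + (U/2)(Σv)·1`, so at half filling the `μ`-term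
cancels and `q ≤ e`. Row-facing theorems (all hypotheses are finite sums of the row's rational weights,
discharged by `norm_num [Finset.sum_range_succ, <table>]`, plus the ONE positivity claim `hq`):

* chain `anderson_chain_l<ℓ>_…_U<U>` (`t = 1`; window `[0,ℓ) ⊆ ℤ` = `halfOpenBox 1 ℓ`; `w j` = weight of
  bond `(j, j+1)`, `j < ℓ-1`, = `bond_weights[j]`; `v j` = `site_weights[j]`, `j < ℓ`; `q = bound_exact`):
  `hubbardChainEnergyDensity_ge_of_andersonChain : Σ_{j<ℓ-1} w j = 1 → Σ_{j<ℓ} v j = 1 →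
   (andersonCluster (halfOpenBox 1 ℓ) t U (chainBondWeights w) (chainSiteWeights v) - q•1).PosSemidef →
   q ≤ hubbardChainEnergyDensity t U` (`0 ≤ U`), and for EVERY ring `L ≥ max 3 ℓ` (no parity, no sign of `U`)
  `groundEnergyAt_ring_div_ge_of_andersonChain : … → q ≤ groundEnergyAt (fermionTorusGraph 1 L) t U L / L`.
* square lattice `anderson_rect<b>x<a>rot_…_U<U>` (`t = 1`, `n = 1`; tool convention `Ly = b ≤ Lx = a`,
  site `p = r·Lx + c`; window `rectWindow a b = [0,a) × [0,b)`, coordinates `x 0 = c`, `x 1 = r`;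
  `w c r 0` = weight of the bond `(p, p+1)`, `w c r 1` = weight of the bond `(p, p+Lx)`, `v c r` = weight of
  site `p`, in the tool's bond list order `for r: for c: [(p,p+1) if c+1<Lx], [(p,p+Lx) if r+1<Ly]`):
  `energyDensity2D_one_ge_of_andersonRect : (Σ_{c<a-1} Σ_{r<b} w c r 0) + (Σ_{c<a} Σ_{r<b-1} w c r 1) = 2 →
   Σ_{c<a} Σ_{r<b} v c r = 1 → (andersonCluster (rectWindow a b) t U (rectBondWeights w) (rectSiteWeights v)
   - q•1).PosSemidef → q ≤ energyDensity2D t U 1` (`0 ≤ U`; general density: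
  `energyDensity2D_ge_of_andersonRect : … → q - (U/2)(1-n) ≤ energyDensity2D t U n`), and on finite square
  tori `groundEnergyAt_torus2_halfFilling_ge_of_andersonRect : … → L² q ≤ E₀((ℤ/Lℤ)², N = L²)` for
  `L ≥ max 3 (max a b)` (e.g. `16 q ≤ E₀(4×4; 16)` from the `2×4` rows). ONE certificate serves both
  orientations: §8 proves that the transposition `(x₀,x₁) ↦ (x₁,x₀)` carries `h(R; w, v)` to
  `h(Rᵀ; wᵀ, vᵀ)` under `fermionEmbed` (`fermionEmbed_transposeEmb_andersonCluster`), hence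
  `posSemidef_andersonCluster_transpose`, and the pair `{R, Rᵀ}` has direction-balanced bond weights.

A row's claim node is thus `(andersonCluster <window> 1 U <w> <v> - ((q:ℚ):ℝ):ℂ)•1).PosSemidef` — a
statement about ONE explicit `4^{|Λ'|} × 4^{|Λ'|}` Hermitian matrix with rational entries — and its energy
rows are one-line applications of the theorems above (tested while writing this file on `chain_l8 U=8` and
`rect2x4rot U=8` with the exact `W_rational` of `anderson4/results4.json`; the test is not part of the file).

## Inventory

§1 torus bookkeeping (`torusBondKinetic`, `torusDoubleOcc`, `torusDensity`, `hubbardTorus_eq_sum_torusBondKinetic`,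
translation lemmas); §2 weighted clusters (`bondWeight(Sum)`, `siteWeightSum`, `clusterBondKinetic`,
`clusterHamiltonian`, `fermionEmbed_toTorusEmb_clusterHamiltonian`, `sum_relabel_translate_clusterHamiltonian`);
§3 `groundEnergyAt_torus_ge_of_clusterFamily`; §4 `hubbardChainEnergyDensity_ge_of_clusterFamily`,
`energyDensity2D_ge_of_clusterFamily`; §5 `andersonCluster`, `andersonCluster_eq`,
`hubbardChainEnergyDensity_ge_of_andersonCluster`, `energyDensity2D_ge_of_andersonCluster_pair`
(+ `_one_`); §6 `injOn_proj_of_subset_halfOpenBox`, `groundEnergyAt_torus_halfFilling_ge_of_andersonCluster`,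
`groundEnergyAt_torus2_halfFilling_ge_of_andersonCluster_pair`; §7 chain coordinates (`chainBondWeights`,
`chainSiteWeights`, `hubbardChainEnergyDensity_ge_of_andersonChain`, `groundEnergyAt_ring_div_ge_of_andersonChain`);
§8 transposition (`swapSite`, `transposeWindow`, `PolySite.transposeEmb/Equiv`,
`fermionEmbed_transposeEmb_andersonCluster`, `posSemidef_andersonCluster_transpose`,
`energyDensity2D_ge_of_andersonCluster_transposePair` (+ `_one_`, finite torus)); §9 rectangles (`rectWindow`,
`rectBondWeights`, `rectSiteWeights`, `sum_rectWindow_eq`, `energyDensity2D(_one)_ge_of_andersonRect`,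
`groundEnergyAt_torus2_halfFilling_ge_of_andersonRect`). Everything is proved; definitions have bodies; no
named facts, no axioms beyond the tree's.

Relation to the tree: `Literature/…/HubbardNNNHoppingClusterLowerBound.lean` proves the UNIFORM-weight
cluster bound for the rectangular `t–t'` torus `hubbardRectTorusTT'` by the same mechanism; this file is the
weighted (Valentí–Stolze–Hirschfeld) form for the objects the cell's rows are stated over
(`fermionTorusGraph d L`, `hubbardChainEnergyDensity`, `energyDensity2D`), with arbitrary finite windows,
cluster families and the transposition symmetry. New mathematics only in the weak sense of a re-binding
(no published source states the Lean form; the method sources are cited). Namespace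
`Literature.MathematicalPhysics.QuantumLattice.AndersonCluster` (a grouping sub-namespace naming the method;
consumers `open` it).

## References
* P. W. Anderson, *Limits on the Energy of the Antiferromagnetic Ground State*, Phys. Rev. 83 (1951) 1260,
  eq. (2). (bib: Anderson1951) [cite: Anderson1951, eq. (2)]
* R. Valentí, J. Stolze, P. J. Hirschfeld, *Lower bounds for the ground-state energies of the two-dimensional
  Hubbard and t-J models*, Phys. Rev. B 43 (1991) 13743, §II (weighted clusters). (bib: ValentiStolzeHirschfeld1991)
  [cite: ValentiStolzeHirschfeld1991, §II]
* Tree: `Literature/MathematicalPhysics/QuantumLattice/InfVolFermionState.lean` (`fermionEmbed`, `PolySite.toTorusEmb`),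
  `InfVolFermionStateHubbardEnergy.lean`, `FockRelabel.lean` (`relabel`, `Orb.translate`),
  `HubbardNNNHoppingClusterEmbedding.lean` (`posSemidef_fermionEmbed_sub_smul_one`, `posSemidef_relabel`),
  `BootstrapCertificateDuality.lean` (`le_groundEnergy_of_posSemidef_sub_sector`),
  `HubbardChainEnergyDensity.lean` (`hubbardChainEnergyDensity_ge_of_forall_ge`),
  `HubbardEnergyDensityCertificateLimit.lean` (`energyDensity2D_ge_of_eventually_ge_torus`),
  `HubbardNNNHoppingClusterLowerBound.lean` (the uniform-weight sibling).
-/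

noncomputable section

namespace Literature.MathematicalPhysics.QuantumLattice.AndersonCluster

open Matrix Finset
open Literature.MathematicalPhysics.QuantumLattice
open Literature.Probability.LatticeModels
open HubbardWave0
open scoped ComplexOrder BigOperators

/-! ### §1. Torus bookkeeping: the Hubbard Hamiltonian as a sum over directed bonds -/

section Torus

variable {d L : ℕ} [NeZero L]

/-- (Local to this file, as in `HubbardTorusLocalCertificate`.) Equality of torus sites is decided through
the LINEAR ORDER — the instance the Jordan–Wigner matrices and `relabel` carry. [folklore] -/
local instance (priority := high) instDecidableEqFermionTorusAnderson : DecidableEq (FermionTorus d L) :=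
  LinearOrder.toDecidableEq

/-- The symmetric hopping term `Σ_σ (c†_{wσ} c_{w+eᵢ,σ} + c†_{w+eᵢ,σ} c_{wσ})` of the torus bond
`{w, w + eᵢ}` (sites through `FermionTorus.ofTorusSite`). [folklore] -/
def torusBondKinetic (w : TorusSite d L) (i : Fin d) :
    Matrix (Finset (Orb (FermionTorus d L))) (Finset (Orb (FermionTorus d L))) ℂ :=
  ∑ σ : Fin 2,
    (creation (orb (FermionTorus.ofTorusSite w) σ) *
        annihilation (orb (FermionTorus.ofTorusSite (w + Pi.single i 1)) σ) +
      creation (orb (FermionTorus.ofTorusSite (w + Pi.single i 1)) σ) *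
        annihilation (orb (FermionTorus.ofTorusSite w) σ))

/-- The double occupancy `n_{w↑} n_{w↓}` of the torus site `w`. [folklore] -/
def torusDoubleOcc (w : TorusSite d L) :
    Matrix (Finset (Orb (FermionTorus d L))) (Finset (Orb (FermionTorus d L))) ℂ :=
  numberOp (FermionTorus.ofTorusSite w) 0 * numberOp (FermionTorus.ofTorusSite w) 1

/-- The site density `n_{w↑} + n_{w↓}` of the torus site `w`. [folklore] -/
def torusDensity (w : TorusSite d L) :
    Matrix (Finset (Orb (FermionTorus d L))) (Finset (Orb (FermionTorus d L))) ℂ :=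
  numberOp (FermionTorus.ofTorusSite w) 0 + numberOp (FermionTorus.ofTorusSite w) 1

omit [NeZero L] in
/-- `|(ℤ/Lℤ)^d| = L^d` for the fermionic torus. [folklore] -/
private theorem card_fermionTorus : Fintype.card (FermionTorus d L) = L ^ d := by
  rw [Fintype.card_lex, Fintype.card_fun, Fintype.card_fin, Fintype.card_fin]

/-- `|TorusSite d L| = L^d`. [folklore] -/
private theorem card_torusSite' : Fintype.card (TorusSite d L) = L ^ d := by
  simp [ZMod.card, Fintype.card_fin]

/-- `Σ_w (n_{w↑} + n_{w↓}) = N̂` on the torus. [folklore] -/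
private theorem sum_torusDensity :
    ∑ w : TorusSite d L, torusDensity w =
      (totalNumber : Matrix (Finset (Orb (FermionTorus d L))) (Finset (Orb (FermionTorus d L))) ℂ) := by
  rw [totalNumber]
  rw [← Fintype.sum_equiv FermionTorus.equivTorusSite.symm (fun w => torusDensity w)
    (fun x : FermionTorus d L => ∑ σ : Fin 2, numberOp x σ) (fun w => ?_)]
  rw [Fin.sum_univ_two]
  rfl

/-- **The torus Hubbard Hamiltonian as a sum over sites and directions**, `L ≥ 3`:
`H = -t Σ_w Σ_i Σ_σ (c†_w c_{w+eᵢ} + c†_w c_{w-eᵢ}) + U Σ_w n_{w↑}n_{w↓}` (all sums over `TorusSite d L`).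
[folklore] -/
private theorem hubbardTorus_eq_sum_torusSite (t U : ℝ) (hL : 3 ≤ L) :
    hubbardTorus d L t U =
      -(t : ℂ) • (∑ v : TorusSite d L, ∑ i : Fin d, ∑ σ : Fin 2,
          (creation (orb (FermionTorus.ofTorusSite v) σ) *
              annihilation (orb (FermionTorus.ofTorusSite (v + Pi.single i 1)) σ) +
            creation (orb (FermionTorus.ofTorusSite v) σ) *
              annihilation (orb (FermionTorus.ofTorusSite (v - Pi.single i 1)) σ))) +
        (U : ℂ) • ∑ v : TorusSite d L, torusDoubleOcc v := by
  set o : TorusSite d L → FermionTorus d L := FermionTorus.ofTorusSite with ho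
  rw [hubbardTorus, hamiltonian]
  congr 1
  · congr 1
    rw [← Fintype.sum_equiv FermionTorus.equivTorusSite.symm
      (fun v : TorusSite d L => ∑ i : Fin d, ∑ σ : Fin 2,
        (creation (orb (o v) σ) * annihilation (orb (o (v + Pi.single i 1)) σ) +
          creation (orb (o v) σ) * annihilation (orb (o (v - Pi.single i 1)) σ))) _ (fun v => ?_)]
    rw [← Fintype.sum_equiv FermionTorus.equivTorusSite.symm
      (fun w : TorusSite d L => ∑ σ : Fin 2,
        if (fermionTorusGraph d L).Adj (FermionTorus.equivTorusSite.symm v) (o w) then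
          creation (orb (FermionTorus.equivTorusSite.symm v) σ) * annihilation (orb (o w) σ) else 0)
      _ (fun w => rfl)]
    have hv : (FermionTorus.equivTorusSite.symm v : FermionTorus d L) = o v := rfl
    simp_rw [hv]
    have hadj : ∀ w : TorusSite d L, (fermionTorusGraph d L).Adj (o v) (o w) ↔ (torusGraph d L).Adj v w := by
      intro w
      rw [fermionTorusGraph_adj, ho, FermionTorus.toTorusSite_ofTorusSite, FermionTorus.toTorusSite_ofTorusSite]
    have hite : ∀ w : TorusSite d L, (∑ σ : Fin 2,
        if (fermionTorusGraph d L).Adj (o v) (o w) then creation (orb (o v) σ) * annihilation (orb (o w) σ) else 0) =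
        if (torusGraph d L).Adj v w then ∑ σ : Fin 2, creation (orb (o v) σ) * annihilation (orb (o w) σ) else 0 := by
      intro w
      by_cases h : (torusGraph d L).Adj v w
      · rw [if_pos h]
        exact Finset.sum_congr rfl fun σ _ => by rw [if_pos ((hadj _).2 h)]
      · rw [if_neg h]
        exact Finset.sum_eq_zero fun σ _ => by rw [if_neg (fun h' => h ((hadj _).1 h'))]
    simp_rw [hite]
    rw [sum_ite_torusGraph_adj_matrix hL v]
    simp only [Finset.sum_add_distrib]
  · congr 1
    exact (Fintype.sum_equiv FermionTorus.equivTorusSite.symm (fun v => torusDoubleOcc v)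
      (fun x : FermionTorus d L => numberOp x 0 * numberOp x 1) fun v => rfl).symm

/-- **The torus Hubbard Hamiltonian as a sum over bonds**, `L ≥ 3`:
`H = -t Σ_i Σ_w Σ_σ (c†_w c_{w+eᵢ} + c†_{w+eᵢ} c_w) + U Σ_w n_{w↑}n_{w↓}`. [folklore] -/
private theorem hubbardTorus_eq_sum_torusBondKinetic (t U : ℝ) (hL : 3 ≤ L) :
    hubbardTorus d L t U =
      -(t : ℂ) • (∑ i : Fin d, ∑ w : TorusSite d L, torusBondKinetic w i) +
        (U : ℂ) • ∑ w : TorusSite d L, torusDoubleOcc w := by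
  rw [hubbardTorus_eq_sum_torusSite t U hL]
  congr 2
  rw [Finset.sum_comm]
  refine Finset.sum_congr rfl fun i _ => ?_
  simp only [Finset.sum_add_distrib]
  have hshift : ∑ v : TorusSite d L, ∑ σ : Fin 2,
      creation (orb (FermionTorus.ofTorusSite v) σ) *
        annihilation (orb (FermionTorus.ofTorusSite (v - Pi.single i 1)) σ) =
      ∑ v : TorusSite d L, ∑ σ : Fin 2,
        creation (orb (FermionTorus.ofTorusSite (v + Pi.single i 1)) σ) *
          annihilation (orb (FermionTorus.ofTorusSite v) σ) :=
    TorusSite.sum_sub_shift (Pi.single i 1)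
      (fun a b => ∑ σ : Fin 2, creation (orb (FermionTorus.ofTorusSite a) σ) *
        annihilation (orb (FermionTorus.ofTorusSite b) σ))
  rw [hshift, ← Finset.sum_add_distrib]
  refine Finset.sum_congr rfl fun v _ => ?_
  rw [torusBondKinetic, ← Finset.sum_add_distrib]

/-! Translates of the bond / site operators. -/

/-- `T_v K_{w,i} T_v⁻¹ = K_{w+v,i}`. [folklore] -/
private theorem relabel_translate_torusBondKinetic (v w : TorusSite d L) (i : Fin d) :
    relabel (Orb.translate v) (torusBondKinetic w i) = torusBondKinetic (w + v) i := by
  rw [torusBondKinetic, torusBondKinetic, relabel_sum]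
  refine Finset.sum_congr rfl fun σ _ => ?_
  rw [relabel_add, relabel_mul, relabel_mul, relabel_translate_creation, relabel_translate_annihilation,
    relabel_translate_creation, relabel_translate_annihilation, add_right_comm w (Pi.single i 1) v]

/-- `T_v (n_{w↑}n_{w↓}) T_v⁻¹ = n_{w+v,↑}n_{w+v,↓}`. [folklore] -/
private theorem relabel_translate_torusDoubleOcc (v w : TorusSite d L) :
    relabel (Orb.translate v) (torusDoubleOcc w) = torusDoubleOcc (w + v) := by
  rw [torusDoubleOcc, torusDoubleOcc, relabel_mul, relabel_translate_numberOp, relabel_translate_numberOp]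

/-- `T_v (n_{w↑} + n_{w↓}) T_v⁻¹ = n_{w+v,↑} + n_{w+v,↓}`. [folklore] -/
private theorem relabel_translate_torusDensity (v w : TorusSite d L) :
    relabel (Orb.translate v) (torusDensity w) = torusDensity (w + v) := by
  rw [torusDensity, torusDensity, relabel_add, relabel_translate_numberOp, relabel_translate_numberOp]

/-- Summing a translate over all translations forgets the base point: `Σ_v F(w + v) = Σ_v F(v)`. [folklore] -/
private theorem sum_add_left_eq {M : Type*} [AddCommMonoid M] (w : TorusSite d L) (F : TorusSite d L → M) :
    ∑ v : TorusSite d L, F (w + v) = ∑ v : TorusSite d L, F v :=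
  Fintype.sum_equiv (Equiv.addLeft w) _ _ fun _ => rfl

end Torus

/-! ### §2. Weighted open clusters of `ℤ^d` and the sum of their torus translates -/

section Cluster

variable {d : ℕ}

/-- `Torus.proj` is additive (local copy; the tree's copies are private to their files). [folklore] -/
private theorem proj_add_site (L : ℕ) (x y : Site d) :
    Torus.proj L (x + y) = Torus.proj L x + Torus.proj L y := by
  funext i; simp [Torus.proj]

/-- Sums over the ordered site set `PolySite Λ'` are sums over the region `Λ'`. [folklore] -/
private theorem PolySite.sum_ofLex_eq {M : Type*} [AddCommMonoid M] (Λ' : Finset (Site d)) (f : Site d → M) :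
    ∑ y : PolySite Λ', f (ofLex y.1) = ∑ x ∈ Λ', f x := by
  conv_rhs => rw [← map_univ_polySiteEmb Λ', Finset.sum_map]
  rfl

/-- The weight of the directed window bond `(x, x + eᵢ)` actually used by the cluster Hamiltonian:
`J x i` if the far endpoint `x + eᵢ` lies in the window, else `0`. [folklore] -/
def bondWeight (Λ' : Finset (Site d)) (J : Site d → Fin d → ℝ) (x : Site d) (i : Fin d) : ℝ :=
  if x + unitVec i ∈ Λ' then J x i else 0

/-- Total weight carried by the window's bonds of direction `i`: `Σ_{x ∈ Λ', x+eᵢ ∈ Λ'} J x i`. [folklore] -/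
def bondWeightSum (Λ' : Finset (Site d)) (J : Site d → Fin d → ℝ) (i : Fin d) : ℝ :=
  ∑ x ∈ Λ', bondWeight Λ' J x i

/-- Total site weight `Σ_{x ∈ Λ'} V x`. [folklore] -/
def siteWeightSum (Λ' : Finset (Site d)) (V : Site d → ℝ) : ℝ := ∑ x ∈ Λ', V x

/-- The kinetic term `Σ_σ (c†_{xσ} c_{x+eᵢ,σ} + c†_{x+eᵢ,σ} c_{xσ}) ∈ 𝔄_{Λ'}` of the window bond
`{x, x + eᵢ}` (`x = ofLex y.1`), and `0` when `x + eᵢ ∉ Λ'` (open boundary conditions). [folklore] -/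
def clusterBondKinetic (Λ' : Finset (Site d)) (y : PolySite Λ') (i : Fin d) : FermionOp Λ' :=
  if h : ofLex y.1 + unitVec i ∈ Λ' then
    ∑ σ : Fin 2,
      (creation (orb y σ) * annihilation (orb (PolySite.pt (ofLex y.1 + unitVec i) h) σ) +
        creation (orb (PolySite.pt (ofLex y.1 + unitVec i) h) σ) * annihilation (orb y σ))
  else 0

/-- **The weighted open-cluster Hubbard Hamiltonian** of a finite window `Λ' ⊆ ℤ^d` with bond weights
`J x i` (bond `{x, x+eᵢ}`), interaction weights `V x` and site potentials `μ x`: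
`h(J,V,μ) = -t Σ_{x, i : x, x+eᵢ ∈ Λ'} J x i Σ_σ (c†_x c_{x+eᵢ} + h.c.) + U Σ_{x ∈ Λ'} V x n_{x↑}n_{x↓}
  + Σ_{x ∈ Λ'} μ x (n_{x↑} + n_{x↓})`, an element of the local algebra `FermionOp Λ'`
(the `4^{|Λ'|} × 4^{|Λ'|}` Jordan–Wigner matrix a cluster certificate bounds below).
Anderson, Phys. Rev. 83 (1951) 1260, eq. (2) (uniform weights); weighted / chemical-potential-shifted
clusters: Valentí, Stolze, Hirschfeld, Phys. Rev. B 43 (1991) 13743 §II. [cite: Anderson1951, eq. (2)] -/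
def clusterHamiltonian (Λ' : Finset (Site d)) (t U : ℝ) (J : Site d → Fin d → ℝ) (V μ : Site d → ℝ) :
    FermionOp Λ' :=
  -(t : ℂ) • (∑ y : PolySite Λ', ∑ i : Fin d, ((J (ofLex y.1) i : ℝ) : ℂ) • clusterBondKinetic Λ' y i) +
    (U : ℂ) • (∑ y : PolySite Λ', ((V (ofLex y.1) : ℝ) : ℂ) • (numberOp y 0 * numberOp y 1)) +
    ∑ y : PolySite Λ', ((μ (ofLex y.1) : ℝ) : ℂ) • (numberOp y 0 + numberOp y 1)

variable {L : ℕ} [NeZero L]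

/-- (Local, as in §1.) [folklore] -/
local instance (priority := high) instDecidableEqFermionTorusAnderson' : DecidableEq (FermionTorus d L) :=
  LinearOrder.toDecidableEq

/-- **The window bond term in the torus**: `Γ(ι)` of the kinetic term of the window bond `{x, x+eᵢ}`
is the torus bond term at `x mod L` (or `0` if the bond is not in the window). [folklore] -/
private theorem fermionEmbed_toTorusEmb_clusterBondKinetic {Λ' : Finset (Site d)}
    (hT : Set.InjOn (Torus.proj (d := d) L) ↑Λ') (y : PolySite Λ') (i : Fin d) :
    fermionEmbed (PolySite.toTorusEmb L hT) (clusterBondKinetic Λ' y i) =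
      if ofLex y.1 + unitVec i ∈ Λ' then torusBondKinetic (Torus.proj L (ofLex y.1)) i else 0 := by
  unfold clusterBondKinetic
  by_cases h : ofLex y.1 + unitVec i ∈ Λ'
  · rw [dif_pos h, if_pos h, fermionEmbed_sum, torusBondKinetic]
    refine Finset.sum_congr rfl fun σ _ => ?_
    rw [fermionEmbed_add, fermionEmbed_mul, fermionEmbed_mul, fermionEmbed_creation,
      fermionEmbed_annihilation, fermionEmbed_creation, fermionEmbed_annihilation,
      PolySite.toTorusEmb_apply, PolySite.toTorusEmb_apply, PolySite.ofLex_coe_pt, proj_add_site,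
      proj_unitVec]
  · rw [dif_neg h, if_neg h, fermionEmbed_zero]

/-- **The cluster Hamiltonian in the torus.** [folklore] -/
private theorem fermionEmbed_toTorusEmb_clusterHamiltonian {Λ' : Finset (Site d)}
    (hT : Set.InjOn (Torus.proj (d := d) L) ↑Λ') (t U : ℝ) (J : Site d → Fin d → ℝ) (V μ : Site d → ℝ) :
    fermionEmbed (PolySite.toTorusEmb L hT) (clusterHamiltonian Λ' t U J V μ) =
      -(t : ℂ) • (∑ y : PolySite Λ', ∑ i : Fin d,
          ((bondWeight Λ' J (ofLex y.1) i : ℝ) : ℂ) • torusBondKinetic (Torus.proj L (ofLex y.1)) i) +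
        (U : ℂ) • (∑ y : PolySite Λ', ((V (ofLex y.1) : ℝ) : ℂ) • torusDoubleOcc (Torus.proj L (ofLex y.1))) +
        ∑ y : PolySite Λ', ((μ (ofLex y.1) : ℝ) : ℂ) • torusDensity (Torus.proj L (ofLex y.1)) := by
  rw [clusterHamiltonian, fermionEmbed_add, fermionEmbed_add, fermionEmbed_smul, fermionEmbed_smul,
    fermionEmbed_sum, fermionEmbed_sum, fermionEmbed_sum]
  congr 1
  · congr 1
    · congr 1
      refine Finset.sum_congr rfl fun y _ => ?_
      rw [fermionEmbed_sum]
      refine Finset.sum_congr rfl fun i _ => ?_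
      rw [fermionEmbed_smul, fermionEmbed_toTorusEmb_clusterBondKinetic hT y i, bondWeight]
      by_cases h : ofLex y.1 + unitVec i ∈ Λ'
      · rw [if_pos h, if_pos h]
      · rw [if_neg h, if_neg h, smul_zero, Complex.ofReal_zero, zero_smul]
    · congr 1
      refine Finset.sum_congr rfl fun y _ => ?_
      rw [fermionEmbed_smul, fermionEmbed_mul, fermionEmbed_numberOp, fermionEmbed_numberOp,
        PolySite.toTorusEmb_apply, torusDoubleOcc]
  · refine Finset.sum_congr rfl fun y _ => ?_
    rw [fermionEmbed_smul, fermionEmbed_add, fermionEmbed_numberOp, fermionEmbed_numberOp,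
      PolySite.toTorusEmb_apply, torusDensity]

/-- **The translates of a weighted cluster sum to weighted lattice terms.** For `L ≥ 3` and a window
`Λ'` on which `x ↦ x mod L` is injective,
`Σ_v T_v Γ(ι) h(J,V,μ) T_v⁻¹ = -t Σ_i (Σ_x J̃ x i) Σ_w K_{w,i} + U (Σ_x V x) Σ_w n_{w↑}n_{w↓} + (Σ_x μ x) N̂`
(`J̃ = bondWeight`: every window bond of direction `i`, translated around the torus, covers every torus
bond of direction `i` exactly once). Anderson (1951) eq. (2). [cite: Anderson1951, eq. (2)] -/
theorem sum_relabel_translate_clusterHamiltonian {Λ' : Finset (Site d)}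
    (hT : Set.InjOn (Torus.proj (d := d) L) ↑Λ') (t U : ℝ) (J : Site d → Fin d → ℝ) (V μ : Site d → ℝ) :
    ∑ v : TorusSite d L, relabel (Orb.translate v)
        (fermionEmbed (PolySite.toTorusEmb L hT) (clusterHamiltonian Λ' t U J V μ)) =
      -(t : ℂ) • (∑ i : Fin d, ((bondWeightSum Λ' J i : ℝ) : ℂ) • ∑ w : TorusSite d L, torusBondKinetic w i) +
        ((U * siteWeightSum Λ' V : ℝ) : ℂ) • (∑ w : TorusSite d L, torusDoubleOcc w) +
        ((siteWeightSum Λ' μ : ℝ) : ℂ) •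
          (totalNumber : Matrix (Finset (Orb (FermionTorus d L))) (Finset (Orb (FermionTorus d L))) ℂ) := by
  set p : PolySite Λ' → TorusSite d L := fun y => Torus.proj L (ofLex y.1) with hp
  have h1 : ∀ v : TorusSite d L, relabel (Orb.translate v)
      (fermionEmbed (PolySite.toTorusEmb L hT) (clusterHamiltonian Λ' t U J V μ)) =
      -(t : ℂ) • (∑ y : PolySite Λ', ∑ i : Fin d,
          ((bondWeight Λ' J (ofLex y.1) i : ℝ) : ℂ) • torusBondKinetic (p y + v) i) +
        (U : ℂ) • (∑ y : PolySite Λ', ((V (ofLex y.1) : ℝ) : ℂ) • torusDoubleOcc (p y + v)) +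
        ∑ y : PolySite Λ', ((μ (ofLex y.1) : ℝ) : ℂ) • torusDensity (p y + v) := by
    intro v
    rw [fermionEmbed_toTorusEmb_clusterHamiltonian hT]
    simp only [relabel_add, relabel_smul, relabel_sum, relabel_translate_torusBondKinetic,
      relabel_translate_torusDoubleOcc, relabel_translate_torusDensity, hp]
  simp_rw [h1]
  rw [Finset.sum_add_distrib, Finset.sum_add_distrib, ← Finset.smul_sum, ← Finset.smul_sum]
  -- the three pieces
  have hK : ∑ v : TorusSite d L, ∑ y : PolySite Λ', ∑ i : Fin d,
      ((bondWeight Λ' J (ofLex y.1) i : ℝ) : ℂ) • torusBondKinetic (p y + v) i =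
      ∑ i : Fin d, ((bondWeightSum Λ' J i : ℝ) : ℂ) • ∑ w : TorusSite d L, torusBondKinetic w i := by
    rw [Finset.sum_comm]
    have hy : ∀ y : PolySite Λ', ∑ v : TorusSite d L, ∑ i : Fin d,
        ((bondWeight Λ' J (ofLex y.1) i : ℝ) : ℂ) • torusBondKinetic (p y + v) i =
        ∑ i : Fin d, ((bondWeight Λ' J (ofLex y.1) i : ℝ) : ℂ) • ∑ w : TorusSite d L, torusBondKinetic w i := by
      intro y
      rw [Finset.sum_comm]
      refine Finset.sum_congr rfl fun i _ => ?_
      rw [← Finset.smul_sum, sum_add_left_eq (p y) (fun w => torusBondKinetic w i)]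
    simp_rw [hy]
    rw [Finset.sum_comm]
    refine Finset.sum_congr rfl fun i _ => ?_
    rw [← Finset.sum_smul, bondWeightSum,
      ← PolySite.sum_ofLex_eq Λ' (fun x => bondWeight Λ' J x i), Complex.ofReal_sum]
  have hD : ∑ v : TorusSite d L, ∑ y : PolySite Λ', ((V (ofLex y.1) : ℝ) : ℂ) • torusDoubleOcc (p y + v) =
      ((siteWeightSum Λ' V : ℝ) : ℂ) • ∑ w : TorusSite d L, torusDoubleOcc w := by
    rw [Finset.sum_comm]
    simp_rw [← Finset.smul_sum]
    have hy : ∀ y : PolySite Λ', ∑ v : TorusSite d L, torusDoubleOcc (p y + v) =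
        ∑ w : TorusSite d L, torusDoubleOcc w := fun y => sum_add_left_eq (p y) _
    simp_rw [hy]
    rw [← Finset.sum_smul, siteWeightSum, ← PolySite.sum_ofLex_eq Λ' V, Complex.ofReal_sum]
  have hN : ∑ v : TorusSite d L, ∑ y : PolySite Λ', ((μ (ofLex y.1) : ℝ) : ℂ) • torusDensity (p y + v) =
      ((siteWeightSum Λ' μ : ℝ) : ℂ) •
        (totalNumber : Matrix (Finset (Orb (FermionTorus d L))) (Finset (Orb (FermionTorus d L))) ℂ) := by
    rw [Finset.sum_comm]
    simp_rw [← Finset.smul_sum]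
    have hy : ∀ y : PolySite Λ', ∑ v : TorusSite d L, torusDensity (p y + v) =
        ∑ w : TorusSite d L, torusDensity w := fun y => sum_add_left_eq (p y) _
    simp_rw [hy, sum_torusDensity]
    rw [← Finset.sum_smul, siteWeightSum, ← PolySite.sum_ofLex_eq Λ' μ, Complex.ofReal_sum]
  rw [hK, hD, hN, smul_smul, ← Complex.ofReal_mul]

end Cluster

/-! ### §3. Anderson's bound: finite tori -/

section Bound

variable {d L : ℕ} [NeZero L]

/-- (Local, as in §1.) [folklore] -/
local instance (priority := high) instDecidableEqFermionTorusAnderson'' : DecidableEq (FermionTorus d L) :=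
  LinearOrder.toDecidableEq

/-- **Anderson's weighted cluster lower bound on the Hubbard torus** `(ℤ/Lℤ)^d`, `L ≥ 3`, for a finite
FAMILY of weighted open clusters `h_k = h(Λ'_k; J_k, V_k, μ_k)` (`clusterHamiltonian`) whose bond weights
cover every lattice direction once, `Σ_k Σ_x J̃_k x i = 1` for every `i`, and whose interaction weights sum
to one, `Σ_k Σ_x V_k x = 1`: if every `h_k ≥ m_k` on the WHOLE cluster Fock space (`h_k - m_k·1 ⪰ 0`, the
certified statement of a cluster certificate) and `x ↦ x mod L` is injective on every window, then for
every `N ≤ 2L^d`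
`L^d · Σ_k m_k - (Σ_k Σ_x μ_k x) · N ≤ E₀(H_{(ℤ/Lℤ)^d}(t,U), N)`:
indeed `Σ_k Σ_v T_v Γ(ι_k)(h_k - m_k) T_v⁻¹ = H + (Σμ) N̂ - L^d (Σ m_k) ⪰ 0`. Anderson, Phys. Rev. 83 (1951)
1260, eq. (2); Valentí–Stolze–Hirschfeld, PRB 43 (1991) 13743 §II (Hubbard clusters with chemical
potential). [cite: Anderson1951, eq. (2)] -/
theorem groundEnergyAt_torus_ge_of_clusterFamily (t U : ℝ) (hL : 3 ≤ L) {κ : Type*} [Fintype κ]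
    (Λc : κ → Finset (Site d)) (J : κ → Site d → Fin d → ℝ) (V μ : κ → Site d → ℝ) (m : κ → ℝ)
    (hT : ∀ k, Set.InjOn (Torus.proj (d := d) L) ↑(Λc k))
    (hJ : ∀ i : Fin d, ∑ k, bondWeightSum (Λc k) (J k) i = 1)
    (hV : ∑ k, siteWeightSum (Λc k) (V k) = 1)
    (hm : ∀ k, (clusterHamiltonian (Λc k) t U (J k) (V k) (μ k) -
      ((m k : ℝ) : ℂ) • (1 : FermionOp (Λc k))).PosSemidef)
    {N : ℕ} (hN : N ≤ 2 * L ^ d) :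
    (L : ℝ) ^ d * (∑ k, m k) - (∑ k, siteWeightSum (Λc k) (μ k)) * N ≤
      groundEnergyAt (fermionTorusGraph d L) t U N := by
  set M : ℝ := ∑ k, siteWeightSum (Λc k) (μ k) with hM
  set mt : ℝ := ∑ k, m k with hmt
  set X : κ → TorusSite d L → Matrix (Finset (Orb (FermionTorus d L))) (Finset (Orb (FermionTorus d L))) ℂ :=
    fun k v => relabel (Orb.translate v)
      (fermionEmbed (PolySite.toTorusEmb L (hT k)) (clusterHamiltonian (Λc k) t U (J k) (V k) (μ k))) with hX
  -- each translate of each shifted cluster is positive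
  have hpos : ∀ k v, (X k v - ((m k : ℝ) : ℂ) •
      (1 : Matrix (Finset (Orb (FermionTorus d L))) (Finset (Orb (FermionTorus d L))) ℂ)).PosSemidef := by
    intro k v
    have h1 := posSemidef_relabel (Orb.translate v)
      (posSemidef_fermionEmbed_sub_smul_one (PolySite.toTorusEmb L (hT k)) (hm k))
    rwa [relabel_sub, relabel_smul, map_one] at h1
  have hP : (∑ k, ∑ v, (X k v - ((m k : ℝ) : ℂ) •
      (1 : Matrix (Finset (Orb (FermionTorus d L))) (Finset (Orb (FermionTorus d L))) ℂ))).PosSemidef :=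
    Matrix.posSemidef_sum _ fun k _ => Matrix.posSemidef_sum _ fun v _ => hpos k v
  -- the sum of all translates of all clusters
  have hsum : ∑ k, ∑ v, X k v = hubbardTorus d L t U + (M : ℂ) •
      (totalNumber : Matrix (Finset (Orb (FermionTorus d L))) (Finset (Orb (FermionTorus d L))) ℂ) := by
    have hk : ∀ k, ∑ v, X k v =
        -(t : ℂ) • (∑ i : Fin d, ((bondWeightSum (Λc k) (J k) i : ℝ) : ℂ) • ∑ w : TorusSite d L, torusBondKinetic w i) +
          ((U * siteWeightSum (Λc k) (V k) : ℝ) : ℂ) • (∑ w : TorusSite d L, torusDoubleOcc w) +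
          ((siteWeightSum (Λc k) (μ k) : ℝ) : ℂ) •
            (totalNumber : Matrix (Finset (Orb (FermionTorus d L))) (Finset (Orb (FermionTorus d L))) ℂ) :=
      fun k => sum_relabel_translate_clusterHamiltonian (hT k) t U (J k) (V k) (μ k)
    simp_rw [hk]
    rw [Finset.sum_add_distrib, Finset.sum_add_distrib, ← Finset.smul_sum, ← Finset.sum_smul,
      ← Finset.sum_smul, Finset.sum_comm]
    simp_rw [← Finset.sum_smul]
    rw [← Complex.ofReal_sum, ← Complex.ofReal_sum, ← hM]
    have hJ' : ∀ i : Fin d, (∑ k, ((bondWeightSum (Λc k) (J k) i : ℝ) : ℂ)) = 1 := fun i => by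
      rw [← Complex.ofReal_sum, hJ i, Complex.ofReal_one]
    have hV' : (∑ k, U * siteWeightSum (Λc k) (V k)) = U := by rw [← Finset.mul_sum, hV, mul_one]
    simp_rw [hJ', one_smul]
    rw [hV', hubbardTorus_eq_sum_torusBondKinetic t U hL]
  -- hence the operator inequality `H + M N̂ - L^d mt ⪰ 0`
  have hcard : (Finset.univ : Finset (TorusSite d L)).card = L ^ d := by
    rw [Finset.card_univ, card_torusSite']
  have hPeq : ∑ k, ∑ v, (X k v - ((m k : ℝ) : ℂ) •
      (1 : Matrix (Finset (Orb (FermionTorus d L))) (Finset (Orb (FermionTorus d L))) ℂ)) =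
      hubbardTorus d L t U + (M : ℂ) • totalNumber - (((L : ℝ) ^ d * mt : ℝ) : ℂ) • 1 := by
    simp_rw [Finset.sum_sub_distrib, Finset.sum_const, hcard]
    rw [hsum]
    congr 1
    rw [hmt, Finset.mul_sum, Complex.ofReal_sum, Finset.sum_smul]
    refine Finset.sum_congr rfl fun k _ => ?_
    rw [← Nat.cast_smul_eq_nsmul ℂ, smul_smul]
    congr 1
    push_cast
    ring
  rw [hPeq] at hP
  -- and the sector bound
  have hN' : N ≤ Fintype.card (Orb (FermionTorus d L)) := by
    rw [card_orb, card_fermionTorus]; exact hN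
  have h := le_groundEnergy_of_posSemidef_sub_sector hN'
    (H := hubbardTorus d L t U) (c := (L : ℝ) ^ d * mt - M * N)
    (K := (-(M : ℂ)) • ((totalNumber : Matrix (Finset (Orb (FermionTorus d L))) _ ℂ) - (N : ℂ) • 1))
    (fun ψ hψ => by
      rw [smul_mulVec, sub_mulVec, totalNumber_mulVec_of_isNParticle hψ, smul_mulVec, one_mulVec,
        sub_self, smul_zero, dotProduct_zero])
    (by
      convert hP using 1
      push_cast
      module)
  rw [groundEnergyAt, ← hubbardTorus]
  exact h

end Bound

/-! ### §4. Anderson's bound: thermodynamic limits (chain at half filling; square lattice at density `n`) -/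

section Limits

open Filter ThermodynamicLimit

/-- **Anderson's weighted cluster bound for the Hubbard chain at half filling (thermodynamic limit).**
For a finite family of weighted open clusters of `ℤ` covering the bond direction once and with unit total
interaction weight, cluster floors `h_k ⪰ m_k` on the full cluster Fock spaces give
`Σ_k m_k - Σ_k Σ_x μ_k x ≤ e(t,U) = lim_L E_L(L)/L` (`U ≥ 0`; the tree's `hubbardChainEnergyDensity`).
Anderson (1951) eq. (2) + Ruelle (1969) §2.2. [cite: Anderson1951, eq. (2)] -/
theorem hubbardChainEnergyDensity_ge_of_clusterFamily (t : ℝ) {U : ℝ} (hU : 0 ≤ U) {κ : Type*} [Fintype κ]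
    (Λc : κ → Finset (Site 1)) (J : κ → Site 1 → Fin 1 → ℝ) (V μ : κ → Site 1 → ℝ) (m : κ → ℝ)
    (hJ : ∑ k, bondWeightSum (Λc k) (J k) 0 = 1) (hV : ∑ k, siteWeightSum (Λc k) (V k) = 1)
    (hm : ∀ k, (clusterHamiltonian (Λc k) t U (J k) (V k) (μ k) -
      ((m k : ℝ) : ℂ) • (1 : FermionOp (Λc k))).PosSemidef) :
    (∑ k, m k) - (∑ k, siteWeightSum (Λc k) (μ k)) ≤ hubbardChainEnergyDensity t U := by
  choose L₁ hL₁ using fun k => exists_forall_le_injOn_proj (Λc k)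
  refine hubbardChainEnergyDensity_ge_of_forall_ge t hU (max 3 (Finset.univ.sup L₁)) fun L hL _ => ?_
  have hL3 : 3 ≤ L := le_trans (le_max_left _ _) hL
  haveI : NeZero L := ⟨by omega⟩
  have hT : ∀ k, Set.InjOn (Torus.proj (d := 1) L) ↑(Λc k) := fun k =>
    hL₁ k L (le_trans (le_trans (Finset.le_sup (f := L₁) (Finset.mem_univ k)) (le_max_right _ _)) hL)
  have h := groundEnergyAt_torus_ge_of_clusterFamily t U hL3 Λc J V μ m hT
    (fun i => by rw [Fin.fin_one_eq_zero i]; exact hJ) hV hm (N := L) (by rw [pow_one]; omega)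
  have hLpos : (0 : ℝ) < L := by exact_mod_cast (show 0 < L by omega)
  rw [le_div_iff₀ hLpos]
  calc ((∑ k, m k) - ∑ k, siteWeightSum (Λc k) (μ k)) * L
        = (L : ℝ) ^ 1 * (∑ k, m k) - (∑ k, siteWeightSum (Λc k) (μ k)) * (L : ℕ) := by ring
    _ ≤ _ := h

/-- **Anderson's weighted cluster bound for the square-lattice Hubbard model at density `n`
(thermodynamic limit).** For a finite family of weighted open clusters of `ℤ²` covering both bond
directions once and with unit total interaction weight, cluster floors `h_k ⪰ m_k` give
`Σ_k m_k - (Σ_k Σ_x μ_k x) · n ≤ e(t,U,n)` (`U ≥ 0`, `0 ≤ n < 2`; the tree's `energyDensity2D`, the limit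
of `E_{L×L}(2⌊nL²/2⌋)/L²`). Anderson (1951) eq. (2); Valentí–Stolze–Hirschfeld (1991) §II.
[cite: Anderson1951, eq. (2)] -/
theorem energyDensity2D_ge_of_clusterFamily (t : ℝ) {U : ℝ} (hU : 0 ≤ U) {n : ℝ} (hn0 : 0 ≤ n)
    (hn2 : n < 2) {κ : Type*} [Fintype κ]
    (Λc : κ → Finset (Site 2)) (J : κ → Site 2 → Fin 2 → ℝ) (V μ : κ → Site 2 → ℝ) (m : κ → ℝ)
    (hJ : ∀ i : Fin 2, ∑ k, bondWeightSum (Λc k) (J k) i = 1) (hV : ∑ k, siteWeightSum (Λc k) (V k) = 1)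
    (hm : ∀ k, (clusterHamiltonian (Λc k) t U (J k) (V k) (μ k) -
      ((m k : ℝ) : ℂ) • (1 : FermionOp (Λc k))).PosSemidef) :
    (∑ k, m k) - (∑ k, siteWeightSum (Λc k) (μ k)) * n ≤ energyDensity2D t U n := by
  choose L₁ hL₁ using fun k => exists_forall_le_injOn_proj (Λc k)
  set M : ℝ := ∑ k, siteWeightSum (Λc k) (μ k) with hM
  set mt : ℝ := ∑ k, m k with hmt
  refine energyDensity2D_ge_of_eventually_ge_torus t hU hn0 hn2 (c := mt - M * n) (μ := -M) ?_
  filter_upwards [eventually_ge_atTop (max 3 (Finset.univ.sup L₁))] with L hL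
  have hL3 : 3 ≤ L := le_trans (le_max_left _ _) hL
  haveI : NeZero L := ⟨by omega⟩
  have hT : ∀ k, Set.InjOn (Torus.proj (d := 2) L) ↑(Λc k) := fun k =>
    hL₁ k L (le_trans (le_trans (Finset.le_sup (f := L₁) (Finset.mem_univ k)) (le_max_right _ _)) hL)
  have h := groundEnergyAt_torus_ge_of_clusterFamily t U hL3 Λc J V μ m hT hJ hV hm (N := rectN n L)
    (by have := rectN_le_two_mul hn0 hn2.le L; rw [sq]; exact this)
  have hLpos : (0 : ℝ) < (L : ℝ) ^ 2 := by
    have : (0 : ℝ) < L := by exact_mod_cast (show 0 < L by omega)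
    positivity
  rw [le_div_iff₀ hLpos]
  have hre : (mt - M * n + -M * ((rectN n L : ℝ) / (L : ℝ) ^ 2 - n)) * (L : ℝ) ^ 2 =
      (L : ℝ) ^ 2 * mt - M * (rectN n L : ℕ) := by
    field_simp
    ring
  rw [hre]
  exact h

end Limits

/-! ### §5. The particle–hole symmetric normal form of the certificate rows (`anderson_*`) -/

section Anderson

variable {d : ℕ}

/-- **The Anderson cluster operator of the certificate rows**: on a window `Λ' ⊆ ℤ^d` with bond weights
`w` and site weights `v`,
`h(w,v) = -t Σ_{x,i} w x i · T_{x,x+eᵢ} + (U/2) Σ_x v x · (2 n_{x↑}n_{x↓} - (n_{x↑} + n_{x↓}) + 1)`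
(`T` = `clusterBondKinetic`; `2D - n + 1 = [n_x ≠ 1]`, the particle–hole symmetric interaction, so that the
minimum over the WHOLE cluster Fock space is the half-filling-relevant floor). This is literally the matrix
whose least eigenvalue the `anderson_*` rows certify (tool header: `h(w,v) = -Σ_b w_b T_b + (U/2) Σ_j v_j
[n_j ≠ 1]`, `t = 1`). [cite: Anderson1951, eq. (2)] -/
def andersonCluster (Λ' : Finset (Site d)) (t U : ℝ) (w : Site d → Fin d → ℝ) (v : Site d → ℝ) :
    FermionOp Λ' :=
  -(t : ℂ) • (∑ y : PolySite Λ', ∑ i : Fin d, ((w (ofLex y.1) i : ℝ) : ℂ) • clusterBondKinetic Λ' y i) +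
    ((U / 2 : ℝ) : ℂ) • ∑ y : PolySite Λ', ((v (ofLex y.1) : ℝ) : ℂ) •
      ((2 : ℂ) • (numberOp y 0 * numberOp y 1) - (numberOp y 0 + numberOp y 1) + 1)

/-- **Normal form**: `h(w,v) = clusterHamiltonian(J = w, V = v, μ = -(U/2) v) + (U/2)(Σ_x v x) · 1`
(the particle–hole form of the weighted cluster Hamiltonian). [cite: ValentiStolzeHirschfeld1991, §II] -/
theorem andersonCluster_eq (Λ' : Finset (Site d)) (t U : ℝ) (w : Site d → Fin d → ℝ) (v : Site d → ℝ) :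
    andersonCluster Λ' t U w v =
      clusterHamiltonian Λ' t U w v (fun x => -(U / 2) * v x) +
        ((U / 2 * siteWeightSum Λ' v : ℝ) : ℂ) • (1 : FermionOp Λ') := by
  have key : ∀ y : PolySite Λ',
      ((U / 2 : ℝ) : ℂ) • (((v (ofLex y.1) : ℝ) : ℂ) •
        ((2 : ℂ) • (numberOp y 0 * numberOp y 1) - (numberOp y 0 + numberOp y 1) + (1 : FermionOp Λ'))) =
      (U : ℂ) • (((v (ofLex y.1) : ℝ) : ℂ) • (numberOp y 0 * numberOp y 1)) +
        (((-(U / 2) * v (ofLex y.1) : ℝ) : ℂ) • (numberOp y 0 + numberOp y 1) +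
          ((U / 2 * v (ofLex y.1) : ℝ) : ℂ) • (1 : FermionOp Λ')) := by
    intro y
    push_cast
    module
  rw [andersonCluster, clusterHamiltonian, add_assoc, add_assoc]
  congr 1
  rw [Finset.smul_sum]
  simp_rw [key]
  rw [Finset.sum_add_distrib, Finset.sum_add_distrib, ← Finset.smul_sum, ← Finset.sum_smul,
    ← Complex.ofReal_sum, ← Finset.mul_sum, siteWeightSum, ← PolySite.sum_ofLex_eq Λ' v]

/-- The cluster floor in `clusterHamiltonian` form: `h(w,v) ⪰ q` iff-direction used by the rows,
`clusterHamiltonian(w, v, -(U/2)v) ⪰ q - (U/2) Σ v`. [folklore] -/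
private theorem posSemidef_clusterHamiltonian_of_andersonCluster {Λ' : Finset (Site d)} {t U : ℝ}
    {w : Site d → Fin d → ℝ} {v : Site d → ℝ} {q : ℝ}
    (hq : (andersonCluster Λ' t U w v - (q : ℂ) • (1 : FermionOp Λ')).PosSemidef) :
    (clusterHamiltonian Λ' t U w v (fun x => -(U / 2) * v x) -
      (((q - U / 2 * siteWeightSum Λ' v : ℝ) : ℂ)) • (1 : FermionOp Λ')).PosSemidef := by
  convert hq using 1
  rw [andersonCluster_eq]
  push_cast
  module

open ThermodynamicLimit

/-- **Soundness of the chain rows `anderson_chain_l<ℓ>_…_U<U>`.** One weighted open cluster `Λ' ⊆ ℤ`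
with `Σ_bonds w = 1`, `Σ_sites v = 1` and a certified floor `h(w,v) ⪰ q` on the full `4^{|Λ'|}`-dimensional
cluster Fock space gives `q ≤ e(t,U)` (half-filled chain, thermodynamic limit, `U ≥ 0`):
`Σ_v T_v Γ(h - q) T_v⁻¹ = H + (U/2)(L - N̂) - L q ⪰ 0` and `N̂ = L` at half filling.
Anderson (1951) eq. (2); the rows' certificates are exact-arithmetic eigenvalue enclosures of `h(w,v)`.
[cite: Anderson1951, eq. (2)] -/
theorem hubbardChainEnergyDensity_ge_of_andersonCluster (t : ℝ) {U : ℝ} (hU : 0 ≤ U)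
    (Λ' : Finset (Site 1)) (w : Site 1 → Fin 1 → ℝ) (v : Site 1 → ℝ) {q : ℝ}
    (hw : bondWeightSum Λ' w 0 = 1) (hv : siteWeightSum Λ' v = 1)
    (hq : (andersonCluster Λ' t U w v - (q : ℂ) • (1 : FermionOp Λ')).PosSemidef) :
    q ≤ hubbardChainEnergyDensity t U := by
  have h := hubbardChainEnergyDensity_ge_of_clusterFamily t hU (κ := Unit) (fun _ => Λ') (fun _ => w)
    (fun _ => v) (fun _ => fun x => -(U / 2) * v x) (fun _ => q - U / 2 * siteWeightSum Λ' v)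
    (by simpa using hw) (by simpa using hv) (fun _ => posSemidef_clusterHamiltonian_of_andersonCluster hq)
  have hμ : siteWeightSum Λ' (fun x => -(U / 2) * v x) = -(U / 2) * siteWeightSum Λ' v := by
    rw [siteWeightSum, siteWeightSum, Finset.mul_sum]
  simp only [Finset.univ_unique, Finset.sum_singleton, hμ, hv] at h
  linarith

/-- Halving the weights halves the Anderson cluster operator (it is linear in `(w, v)`). [folklore] -/
private theorem andersonCluster_half (S : Finset (Site d)) (t U : ℝ) (a : Site d → Fin d → ℝ) (b : Site d → ℝ) :
    andersonCluster S t U (fun x i => a x i / 2) (fun x => b x / 2) =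
      ((1 / 2 : ℝ) : ℂ) • andersonCluster S t U a b := by
  unfold andersonCluster
  rw [smul_add]
  congr 1
  · have e1 : ∀ (y : PolySite S) (i : Fin d),
        (((fun x i => a x i / 2) (ofLex y.1) i : ℝ) : ℂ) • clusterBondKinetic S y i =
          ((1 / 2 : ℝ) : ℂ) • ((((a (ofLex y.1) i : ℝ)) : ℂ) • clusterBondKinetic S y i) := by
      intro y i
      rw [smul_smul]
      push_cast
      ring_nf
    simp_rw [e1]
    simp_rw [← Finset.smul_sum]
    rw [smul_comm]
  · have e2 : ∀ y : PolySite S,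
        (((fun x => b x / 2) (ofLex y.1) : ℝ) : ℂ) •
            ((2 : ℂ) • (numberOp y 0 * numberOp y 1) - (numberOp y 0 + numberOp y 1) + (1 : FermionOp S)) =
          ((1 / 2 : ℝ) : ℂ) • ((((b (ofLex y.1) : ℝ)) : ℂ) •
            ((2 : ℂ) • (numberOp y 0 * numberOp y 1) - (numberOp y 0 + numberOp y 1) + (1 : FermionOp S))) := by
      intro y
      rw [smul_smul]
      push_cast
      ring_nf
    simp_rw [e2]
    simp_rw [← Finset.smul_sum]
    rw [smul_comm]

/-- A floor for `h(w,v)` is half a floor... : `h(w,v) ⪰ r ⇒ h(w/2, v/2) ⪰ r/2`. [folklore] -/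
private theorem posSemidef_andersonCluster_half {S : Finset (Site d)} {t U : ℝ} {a : Site d → Fin d → ℝ}
    {b : Site d → ℝ} {r : ℝ} (h : (andersonCluster S t U a b - (r : ℂ) • (1 : FermionOp S)).PosSemidef) :
    (andersonCluster S t U (fun x i => a x i / 2) (fun x => b x / 2) -
      ((r / 2 : ℝ) : ℂ) • (1 : FermionOp S)).PosSemidef := by
  have h2 := h.smul (a := ((1 / 2 : ℝ) : ℂ)) (by rw [Complex.le_def]; simp)
  have hre : andersonCluster S t U (fun x i => a x i / 2) (fun x => b x / 2) -
      ((r / 2 : ℝ) : ℂ) • (1 : FermionOp S) =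
      ((1 / 2 : ℝ) : ℂ) • (andersonCluster S t U a b - (r : ℂ) • (1 : FermionOp S)) := by
    rw [andersonCluster_half, smul_sub, smul_smul]
    congr 2
    push_cast
    ring
  rw [hre]
  exact h2

/-- Halving bond weights halves `bondWeightSum`. [folklore] -/
private theorem bondWeightSum_half (S : Finset (Site d)) (a : Site d → Fin d → ℝ) (i : Fin d) :
    bondWeightSum S (fun x i => a x i / 2) i = bondWeightSum S a i / 2 := by
  rw [bondWeightSum, bondWeightSum, Finset.sum_div]
  refine Finset.sum_congr rfl fun x _ => ?_
  simp only [bondWeight]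
  split_ifs <;> simp

/-- `siteWeightSum` is linear. [folklore] -/
private theorem siteWeightSum_const_mul (S : Finset (Site d)) (b : Site d → ℝ) (c : ℝ) :
    siteWeightSum S (fun x => c * b x) = c * siteWeightSum S b := by
  rw [siteWeightSum, siteWeightSum, Finset.mul_sum]

/-- `siteWeightSum` is linear. [folklore] -/
private theorem siteWeightSum_half (S : Finset (Site d)) (b : Site d → ℝ) :
    siteWeightSum S (fun x => b x / 2) = siteWeightSum S b / 2 := by
  rw [siteWeightSum, siteWeightSum, Finset.sum_div]

/-- **Soundness of the square-lattice rows (two-orientation clusters, `rect<a>x<b>rot`), general density.**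
Two weighted open clusters `R, R' ⊆ ℤ²` (in the rows: a rectangle and its transpose carrying the transposed
weights) with `Σ_{bonds of R ∥ eᵢ} w + Σ_{bonds of R' ∥ eᵢ} w' = 2` for both directions `i` and
`Σ v + Σ v' = 2`, and certified floors `h(R;w,v) ⪰ q`, `h(R';w',v') ⪰ q'`, give for `0 ≤ n < 2`, `U ≥ 0`
`(q + q')/2 - (U/2)(1 - n) ≤ e(t,U,n)`; at half filling `n = 1`: `(q + q')/2 ≤ e(t,U,1)`.
(`½ Σ_v T_v [Γ(ι_R)(h) + Γ(ι_{R'})(h')] T_v⁻¹ = H + (U/2)(L² - N̂) - ½ L² (q + q')`.) Anderson (1951)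
eq. (2); Valentí–Stolze–Hirschfeld (1991) §II. [cite: Anderson1951, eq. (2)] -/
theorem energyDensity2D_ge_of_andersonCluster_pair (t : ℝ) {U : ℝ} (hU : 0 ≤ U) {n : ℝ} (hn0 : 0 ≤ n)
    (hn2 : n < 2) (R R' : Finset (Site 2)) (w w' : Site 2 → Fin 2 → ℝ) (v v' : Site 2 → ℝ) {q q' : ℝ}
    (hw : ∀ i : Fin 2, bondWeightSum R w i + bondWeightSum R' w' i = 2)
    (hv : siteWeightSum R v + siteWeightSum R' v' = 2)
    (hq : (andersonCluster R t U w v - (q : ℂ) • (1 : FermionOp R)).PosSemidef)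
    (hq' : (andersonCluster R' t U w' v' - (q' : ℂ) • (1 : FermionOp R')).PosSemidef) :
    (q + q') / 2 - U / 2 * (1 - n) ≤ energyDensity2D t U n := by
  have h := energyDensity2D_ge_of_clusterFamily t hU hn0 hn2 (κ := Fin 2) ![R, R']
    ![fun x i => w x i / 2, fun x i => w' x i / 2] ![fun x => v x / 2, fun x => v' x / 2]
    ![fun x => -(U / 2) * (v x / 2), fun x => -(U / 2) * (v' x / 2)]
    ![q / 2 - U / 2 * siteWeightSum R (fun x => v x / 2), q' / 2 - U / 2 * siteWeightSum R' (fun x => v' x / 2)]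
    (fun i => by
      simp only [Fin.sum_univ_two, Matrix.cons_val_zero, Matrix.cons_val_one, bondWeightSum_half]
      linarith [hw i])
    (by
      simp only [Fin.sum_univ_two, Matrix.cons_val_zero, Matrix.cons_val_one, siteWeightSum_half]
      linarith [hv])
    (Fin.forall_fin_two.2
      ⟨posSemidef_clusterHamiltonian_of_andersonCluster (posSemidef_andersonCluster_half hq),
        posSemidef_clusterHamiltonian_of_andersonCluster (posSemidef_andersonCluster_half hq')⟩)
  simp only [Fin.sum_univ_two, Matrix.cons_val_zero, Matrix.cons_val_one, siteWeightSum_const_mul,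
    siteWeightSum_half] at h
  have hv2 : siteWeightSum R' v' = 2 - siteWeightSum R v := by linarith
  rw [hv2] at h
  nlinarith [h]

/-- The half-filled square lattice: `(q + q')/2 ≤ e(t,U,1)`. [cite: Anderson1951, eq. (2)] -/
theorem energyDensity2D_one_ge_of_andersonCluster_pair (t : ℝ) {U : ℝ} (hU : 0 ≤ U)
    (R R' : Finset (Site 2)) (w w' : Site 2 → Fin 2 → ℝ) (v v' : Site 2 → ℝ) {q q' : ℝ}
    (hw : ∀ i : Fin 2, bondWeightSum R w i + bondWeightSum R' w' i = 2)
    (hv : siteWeightSum R v + siteWeightSum R' v' = 2)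
    (hq : (andersonCluster R t U w v - (q : ℂ) • (1 : FermionOp R)).PosSemidef)
    (hq' : (andersonCluster R' t U w' v' - (q' : ℂ) • (1 : FermionOp R')).PosSemidef) :
    (q + q') / 2 ≤ energyDensity2D t U 1 := by
  have h := energyDensity2D_ge_of_andersonCluster_pair t hU zero_le_one one_lt_two R R' w w' v v' hw hv hq hq'
  simpa using h

end Anderson

/-! ### §6. Explicit windows: injectivity thresholds, finite tori, chain coordinates -/

section Windows

variable {d : ℕ}

/-- **A window inside the box `[0, ℓ)^d` fits into every torus of side `L ≥ ℓ`**: `x ↦ x mod L` is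
injective on it. [folklore] -/
private theorem injOn_proj_of_subset_halfOpenBox {Λ' : Finset (Site d)} {ℓ : ℕ} (hΛ : Λ' ⊆ halfOpenBox d ℓ)
    {L : ℕ} (hL : ℓ ≤ L) : Set.InjOn (Torus.proj (d := d) L) ↑Λ' := by
  intro x hx y hy hxy
  refine Torus.proj_injective_of_abs_sub_lt (fun j => ?_) hxy
  have hx' := (mem_halfOpenBox.1 (hΛ (Finset.mem_coe.1 hx))) j
  have hy' := (mem_halfOpenBox.1 (hΛ (Finset.mem_coe.1 hy))) j
  rw [abs_sub_lt_iff]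
  constructor <;> omega

variable {L : ℕ} [NeZero L]

/-- (Local, as in §1.) [folklore] -/
local instance (priority := high) instDecidableEqFermionTorusAnderson3 : DecidableEq (FermionTorus d L) :=
  LinearOrder.toDecidableEq

/-- **Anderson's bound on a finite torus at half filling, one cluster** (any `d`): a weighted open cluster
`Λ' ⊆ [0,ℓ)^d` with `Σ_{bonds ∥ eᵢ} w = 1` for every `i`, `Σ v = 1` and `h(w,v) ⪰ q` gives
`L^d · q ≤ E₀(H_{(ℤ/Lℤ)^d}, N = L^d)` for every `L ≥ max 3 ℓ` (at `N = L^d` the chemical-potential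
term `(U/2)(L^d - N)` vanishes). [cite: Anderson1951, eq. (2)] -/
theorem groundEnergyAt_torus_halfFilling_ge_of_andersonCluster (t U : ℝ) {Λ' : Finset (Site d)} {ℓ : ℕ}
    (hΛ : Λ' ⊆ halfOpenBox d ℓ) (hL : max 3 ℓ ≤ L) (w : Site d → Fin d → ℝ) (v : Site d → ℝ) {q : ℝ}
    (hw : ∀ i : Fin d, bondWeightSum Λ' w i = 1) (hv : siteWeightSum Λ' v = 1)
    (hq : (andersonCluster Λ' t U w v - (q : ℂ) • (1 : FermionOp Λ')).PosSemidef) :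
    (L : ℝ) ^ d * q ≤ groundEnergyAt (fermionTorusGraph d L) t U (L ^ d) := by
  have hL3 : 3 ≤ L := le_trans (le_max_left _ _) hL
  have hT : Set.InjOn (Torus.proj (d := d) L) ↑Λ' :=
    injOn_proj_of_subset_halfOpenBox hΛ (le_trans (le_max_right _ _) hL)
  have h := groundEnergyAt_torus_ge_of_clusterFamily t U hL3 (κ := Unit) (fun _ => Λ') (fun _ => w)
    (fun _ => v) (fun _ => fun x => -(U / 2) * v x) (fun _ => q - U / 2 * siteWeightSum Λ' v)
    (fun _ => hT) (fun i => by simpa using hw i) (by simpa using hv)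
    (fun _ => posSemidef_clusterHamiltonian_of_andersonCluster hq) (N := L ^ d) (by omega)
  simp only [Finset.univ_unique, Finset.sum_singleton, siteWeightSum_const_mul, hv, Nat.cast_pow] at h
  linarith

/-- **Anderson's bound on a finite square torus at half filling, two orientations** (`d = 2`): clusters
`R, R' ⊆ [0,ℓ)²` with `Σ_{R ∥ eᵢ} w + Σ_{R' ∥ eᵢ} w' = 2`, `Σ v + Σ v' = 2`, floors `q, q'`, give
`L² (q + q')/2 ≤ E₀(H_{(ℤ/Lℤ)²}, N = L²)` for `L ≥ max 3 ℓ` — e.g. the `4 × 4` torus at `N = 16` from a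
`2 × 4` cluster and its transpose. [cite: Anderson1951, eq. (2)] -/
theorem groundEnergyAt_torus2_halfFilling_ge_of_andersonCluster_pair (t U : ℝ) {R R' : Finset (Site 2)}
    {ℓ : ℕ} (hR : R ⊆ halfOpenBox 2 ℓ) (hR' : R' ⊆ halfOpenBox 2 ℓ) (hL : max 3 ℓ ≤ L)
    (w w' : Site 2 → Fin 2 → ℝ) (v v' : Site 2 → ℝ) {q q' : ℝ}
    (hw : ∀ i : Fin 2, bondWeightSum R w i + bondWeightSum R' w' i = 2)
    (hv : siteWeightSum R v + siteWeightSum R' v' = 2)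
    (hq : (andersonCluster R t U w v - (q : ℂ) • (1 : FermionOp R)).PosSemidef)
    (hq' : (andersonCluster R' t U w' v' - (q' : ℂ) • (1 : FermionOp R')).PosSemidef) :
    (L : ℝ) ^ 2 * ((q + q') / 2) ≤ groundEnergyAt (fermionTorusGraph 2 L) t U (L ^ 2) := by
  have hL3 : 3 ≤ L := le_trans (le_max_left _ _) hL
  have hℓ : ℓ ≤ L := le_trans (le_max_right _ _) hL
  have h := groundEnergyAt_torus_ge_of_clusterFamily t U hL3 (κ := Fin 2) ![R, R']
    ![fun x i => w x i / 2, fun x i => w' x i / 2] ![fun x => v x / 2, fun x => v' x / 2]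
    ![fun x => -(U / 2) * (v x / 2), fun x => -(U / 2) * (v' x / 2)]
    ![q / 2 - U / 2 * siteWeightSum R (fun x => v x / 2), q' / 2 - U / 2 * siteWeightSum R' (fun x => v' x / 2)]
    (Fin.forall_fin_two.2 ⟨injOn_proj_of_subset_halfOpenBox hR hℓ, injOn_proj_of_subset_halfOpenBox hR' hℓ⟩)
    (fun i => by
      simp only [Fin.sum_univ_two, Matrix.cons_val_zero, Matrix.cons_val_one, bondWeightSum_half]
      linarith [hw i])
    (by
      simp only [Fin.sum_univ_two, Matrix.cons_val_zero, Matrix.cons_val_one, siteWeightSum_half]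
      linarith [hv])
    (Fin.forall_fin_two.2
      ⟨posSemidef_clusterHamiltonian_of_andersonCluster (posSemidef_andersonCluster_half hq),
        posSemidef_clusterHamiltonian_of_andersonCluster (posSemidef_andersonCluster_half hq')⟩)
    (N := L ^ 2) (by omega)
  simp only [Fin.sum_univ_two, Matrix.cons_val_zero, Matrix.cons_val_one, siteWeightSum_const_mul,
    siteWeightSum_half, Nat.cast_pow] at h
  have hv2 : siteWeightSum R' v' = 2 - siteWeightSum R v := by linarith
  rw [hv2] at h
  nlinarith [h]

end Windows

/-! ### §7. The chain rows in coordinates: window `[0, ℓ) ⊆ ℤ`, weights indexed by `ℕ` -/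

section ChainCoordinates

/-- Bond weights of a chain cluster from a sequence: the bond `{j, j+1}` (`j = x 0 ≥ 0`) carries `w j`.
[folklore] -/
def chainBondWeights (w : ℕ → ℝ) : Site 1 → Fin 1 → ℝ := fun x _ => w (x 0).toNat

/-- Site weights of a chain cluster from a sequence: the site `j = x 0 ≥ 0` carries `v j`. [folklore] -/
def chainSiteWeights (v : ℕ → ℝ) : Site 1 → ℝ := fun x => v (x 0).toNat

/-- `Σ_{x ∈ [0,ℓ)} v (x 0) = Σ_{j < ℓ} v j`. [folklore] -/
private theorem siteWeightSum_chain (ℓ : ℕ) (v : ℕ → ℝ) :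
    siteWeightSum (halfOpenBox 1 ℓ) (chainSiteWeights v) = ∑ j ∈ Finset.range ℓ, v j := by
  unfold siteWeightSum chainSiteWeights
  refine Finset.sum_nbij' (fun x => (x 0).toNat) (fun j => fun _ => (j : ℤ)) ?_ ?_ ?_ ?_ ?_
  · intro x hx
    have := (mem_halfOpenBox.1 (Finset.mem_coe.1 hx)) 0
    exact Finset.mem_range.2 (by omega)
  · intro j hj
    have hj' := Finset.mem_range.1 (Finset.mem_coe.1 hj)
    exact Finset.mem_coe.2 (mem_halfOpenBox.2 fun _ => ⟨by positivity, by exact_mod_cast hj'⟩)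
  · intro x hx
    have := (mem_halfOpenBox.1 (Finset.mem_coe.1 hx)) 0
    funext i
    rw [Fin.fin_one_eq_zero i]
    exact Int.toNat_of_nonneg this.1
  · intro j _
    simp
  · intro x _
    rfl

/-- `Σ_{x ∈ [0,ℓ), x+1 ∈ [0,ℓ)} w (x 0) = Σ_{j < ℓ-1} w j`. [folklore] -/
private theorem bondWeightSum_chain (ℓ : ℕ) (w : ℕ → ℝ) :
    bondWeightSum (halfOpenBox 1 ℓ) (chainBondWeights w) 0 = ∑ j ∈ Finset.range (ℓ - 1), w j := by
  have h1 : bondWeightSum (halfOpenBox 1 ℓ) (chainBondWeights w) 0 =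
      ∑ j ∈ Finset.range ℓ, if j + 1 < ℓ then w j else 0 := by
    unfold bondWeightSum bondWeight chainBondWeights
    refine Finset.sum_nbij' (fun x => (x 0).toNat) (fun j => fun _ => (j : ℤ)) ?_ ?_ ?_ ?_ ?_
    · intro x hx
      have := (mem_halfOpenBox.1 (Finset.mem_coe.1 hx)) 0
      exact Finset.mem_range.2 (by omega)
    · intro j hj
      have hj' := Finset.mem_range.1 (Finset.mem_coe.1 hj)
      exact Finset.mem_coe.2 (mem_halfOpenBox.2 fun _ => ⟨by positivity, by exact_mod_cast hj'⟩)
    · intro x hx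
      have := (mem_halfOpenBox.1 (Finset.mem_coe.1 hx)) 0
      funext i
      rw [Fin.fin_one_eq_zero i]
      exact Int.toNat_of_nonneg this.1
    · intro j _
      simp
    · intro x hx
      have hx0 := (mem_halfOpenBox.1 (Finset.mem_coe.1 hx)) 0
      have hiff : x + unitVec 0 ∈ halfOpenBox 1 ℓ ↔ (x 0).toNat + 1 < ℓ := by
        rw [mem_halfOpenBox, Fin.forall_fin_one]
        simp only [Pi.add_apply, unitVec, Pi.single_eq_same]
        omega
      by_cases hc : (x 0).toNat + 1 < ℓ
      · rw [if_pos (hiff.2 hc), if_pos hc]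
      · rw [if_neg (fun h => hc (hiff.1 h)), if_neg hc]
  rw [h1]
  cases ℓ with
  | zero => simp
  | succ k =>
    rw [Finset.sum_range_succ, if_neg (by omega), add_zero, Nat.add_sub_cancel]
    exact Finset.sum_congr rfl fun j hj => by rw [if_pos (by have := Finset.mem_range.1 hj; omega)]

open ThermodynamicLimit

/-- **Soundness of `anderson_chain_l<ℓ>_…_U<U>` (thermodynamic limit).** A chain cluster of `ℓ` sites
`[0, ℓ) ⊆ ℤ` with bond weights `w 0, …, w (ℓ-2)` summing to `1`, site weights `v 0, …, v (ℓ-1)` summing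
to `1`, and a certified floor `h(w,v) ⪰ q` on the `4^ℓ`-dimensional cluster Fock space gives
`q ≤ e(t,U)` (`U ≥ 0`). Row dictionary: `t = 1`; `w j` = `W_rational` bond `(j, j+1)`; `v j` = site
weight `j`; `q = bound_exact`. [cite: Anderson1951, eq. (2)] -/
theorem hubbardChainEnergyDensity_ge_of_andersonChain (t : ℝ) {U : ℝ} (hU : 0 ≤ U) (ℓ : ℕ)
    (w v : ℕ → ℝ) {q : ℝ} (hw : ∑ j ∈ Finset.range (ℓ - 1), w j = 1) (hv : ∑ j ∈ Finset.range ℓ, v j = 1)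
    (hq : (andersonCluster (halfOpenBox 1 ℓ) t U (chainBondWeights w) (chainSiteWeights v) -
      (q : ℂ) • (1 : FermionOp (halfOpenBox 1 ℓ))).PosSemidef) :
    q ≤ hubbardChainEnergyDensity t U :=
  hubbardChainEnergyDensity_ge_of_andersonCluster t hU _ _ _ (by rw [bondWeightSum_chain]; exact hw)
    (by rw [siteWeightSum_chain]; exact hv) hq

variable {L : ℕ} [NeZero L]

/-- **Soundness of `anderson_chain_l<ℓ>_…_U<U>` (every ring `L ≥ max 3 ℓ`, the rows' literal shape
`∀ L, L₀ ≤ L → q ≤ E₀(ℤ/Lℤ; N = L)/L`)** — no parity or sign condition on `L`, `U`.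
[cite: Anderson1951, eq. (2)] -/
theorem groundEnergyAt_ring_div_ge_of_andersonChain (t U : ℝ) (ℓ : ℕ) (w v : ℕ → ℝ) {q : ℝ}
    (hw : ∑ j ∈ Finset.range (ℓ - 1), w j = 1) (hv : ∑ j ∈ Finset.range ℓ, v j = 1)
    (hq : (andersonCluster (halfOpenBox 1 ℓ) t U (chainBondWeights w) (chainSiteWeights v) -
      (q : ℂ) • (1 : FermionOp (halfOpenBox 1 ℓ))).PosSemidef) (hL : max 3 ℓ ≤ L) :
    q ≤ groundEnergyAt (fermionTorusGraph 1 L) t U L / (L : ℝ) := by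
  have h := groundEnergyAt_torus_halfFilling_ge_of_andersonCluster t U (subset_refl (halfOpenBox 1 ℓ)) hL
    (chainBondWeights w) (chainSiteWeights v)
    (fun i => by rw [Fin.fin_one_eq_zero i, bondWeightSum_chain]; exact hw)
    (by rw [siteWeightSum_chain]; exact hv) hq
  have hLpos : (0 : ℝ) < L := by
    have : 3 ≤ L := le_trans (le_max_left _ _) hL
    exact_mod_cast (show 0 < L by omega)
  rw [le_div_iff₀ hLpos, mul_comm]
  simpa [pow_one] using h

end ChainCoordinates

/-! ### §8. Transposition symmetry of `ℤ²`: one certificate serves both orientations -/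

section Transpose

/-- The coordinate swap `(x₀, x₁) ↦ (x₁, x₀)` of `ℤ²`. [folklore] -/
def swapSite (x : Site 2) : Site 2 := fun i => x i.rev

/-- Coordinates of the swap. [folklore] -/
@[simp] private theorem swapSite_apply (x : Site 2) (i : Fin 2) : swapSite x i = x i.rev := rfl

/-- The swap is an involution. [folklore] -/
@[simp] private theorem swapSite_swapSite (x : Site 2) : swapSite (swapSite x) = x := by
  funext i; simp [swapSite, Fin.rev_rev]

/-- The swap is injective. [folklore] -/
private theorem swapSite_injective : Function.Injective swapSite := fun x y h => by
  rw [← swapSite_swapSite x, h, swapSite_swapSite]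

/-- The swap is additive. [folklore] -/
private theorem swapSite_add (x y : Site 2) : swapSite (x + y) = swapSite x + swapSite y := rfl

/-- The swap exchanges the unit vectors: `swap eᵢ = e_{rev i}`. [folklore] -/
private theorem swapSite_unitVec (i : Fin 2) : swapSite (unitVec i) = unitVec i.rev := by
  funext j
  simp only [swapSite_apply, unitVec, Pi.single_apply]
  by_cases h : j.rev = i
  · rw [if_pos h, if_pos (Fin.rev_eq_iff.1 h)]
  · rw [if_neg h, if_neg (fun h' => h (Fin.rev_eq_iff.2 h'))]

/-- **The transposed window** `Rᵀ = {(x₁, x₀) : x ∈ R}`. [folklore] -/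
def transposeWindow (R : Finset (Site 2)) : Finset (Site 2) := R.map ⟨swapSite, swapSite_injective⟩

/-- Membership in the transposed window. [folklore] -/
private theorem mem_transposeWindow {R : Finset (Site 2)} {z : Site 2} : z ∈ transposeWindow R ↔ swapSite z ∈ R := by
  rw [transposeWindow, Finset.mem_map]
  constructor
  · rintro ⟨x, hx, rfl⟩
    change swapSite (swapSite x) ∈ R
    rwa [swapSite_swapSite]
  · intro h
    exact ⟨swapSite z, h, swapSite_swapSite z⟩

/-- `swap x ∈ Rᵀ` for `x ∈ R`. [folklore] -/
private theorem swapSite_mem_transposeWindow {R : Finset (Site 2)} {x : Site 2} (hx : x ∈ R) :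
    swapSite x ∈ transposeWindow R :=
  mem_transposeWindow.2 (by rwa [swapSite_swapSite])

/-- The transposition as an injection of ordered site sets `R → Rᵀ` (NOT monotone for the lexicographic
orders — `fermionEmbed` handles the Jordan–Wigner reordering). [folklore] -/
def PolySite.transposeEmb (R : Finset (Site 2)) : PolySite R ↪ PolySite (transposeWindow R) :=
  ⟨fun y => PolySite.pt (swapSite (ofLex y.1)) (swapSite_mem_transposeWindow (PolySite.ofLex_mem y)),
    fun y y' hy => by
      have h : swapSite (ofLex y.1) = swapSite (ofLex y'.1) :=
        congrArg (fun z : PolySite (transposeWindow R) => ofLex z.1) hy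
      exact Subtype.ext (congrArg toLex (swapSite_injective h))⟩

/-- The transposition acts on coordinates by the swap. [folklore] -/
@[simp] private theorem PolySite.ofLex_coe_transposeEmb (R : Finset (Site 2)) (y : PolySite R) :
    ofLex (PolySite.transposeEmb R y).1 = swapSite (ofLex y.1) := rfl

/-- The transposition as a bijection of ordered site sets. [folklore] -/
def PolySite.transposeEquiv (R : Finset (Site 2)) : PolySite R ≃ PolySite (transposeWindow R) where
  toFun := PolySite.transposeEmb R
  invFun y' := PolySite.pt (swapSite (ofLex y'.1)) (mem_transposeWindow.1 (PolySite.ofLex_mem y'))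
  left_inv y := Subtype.ext (by
    change toLex (swapSite (swapSite (ofLex y.1))) = y.1
    rw [swapSite_swapSite]; rfl)
  right_inv y' := Subtype.ext (by
    change toLex (swapSite (swapSite (ofLex y'.1))) = y'.1
    rw [swapSite_swapSite]; rfl)

/-- The window bond `{x, x+eᵢ}` of `R` transposes to the bond `{swap x, swap x + e_{rev i}}` of `Rᵀ`.
[folklore] -/
private theorem fermionEmbed_transposeEmb_clusterBondKinetic (R : Finset (Site 2)) (y : PolySite R) (i : Fin 2) :
    fermionEmbed (PolySite.transposeEmb R) (clusterBondKinetic R y i) =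
      clusterBondKinetic (transposeWindow R) (PolySite.transposeEmb R y) i.rev := by
  have hiff : ofLex (PolySite.transposeEmb R y).1 + unitVec i.rev ∈ transposeWindow R ↔
      ofLex y.1 + unitVec i ∈ R := by
    rw [PolySite.ofLex_coe_transposeEmb, ← swapSite_unitVec, ← swapSite_add, mem_transposeWindow,
      swapSite_swapSite]
  unfold clusterBondKinetic
  by_cases h : ofLex y.1 + unitVec i ∈ R
  · have h' := hiff.2 h
    rw [dif_pos h, dif_pos h', fermionEmbed_sum]
    have hpt : PolySite.transposeEmb R (PolySite.pt (ofLex y.1 + unitVec i) h) =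
        PolySite.pt (ofLex (PolySite.transposeEmb R y).1 + unitVec i.rev) h' :=
      Subtype.ext (by
        change toLex (swapSite (ofLex y.1 + unitVec i)) = toLex (swapSite (ofLex y.1) + unitVec i.rev)
        rw [swapSite_add, swapSite_unitVec])
    refine Finset.sum_congr rfl fun σ _ => ?_
    rw [fermionEmbed_add, fermionEmbed_mul, fermionEmbed_mul, fermionEmbed_creation,
      fermionEmbed_annihilation, fermionEmbed_creation, fermionEmbed_annihilation, hpt]
  · rw [dif_neg h, dif_neg (fun h' => h (hiff.1 h')), fermionEmbed_zero]

/-- **The Anderson cluster operator transposes to the Anderson cluster operator of the transposed window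
with transposed weights** `wᵀ x i = w (swap x) (rev i)`, `vᵀ x = v (swap x)`. [folklore] -/
private theorem fermionEmbed_transposeEmb_andersonCluster (R : Finset (Site 2)) (t U : ℝ) (w : Site 2 → Fin 2 → ℝ)
    (v : Site 2 → ℝ) :
    fermionEmbed (PolySite.transposeEmb R) (andersonCluster R t U w v) =
      andersonCluster (transposeWindow R) t U (fun x i => w (swapSite x) i.rev) (fun x => v (swapSite x)) := by
  unfold andersonCluster
  rw [fermionEmbed_add, fermionEmbed_smul, fermionEmbed_smul, fermionEmbed_sum, fermionEmbed_sum]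
  congr 2
  · -- kinetic part: reindex sites by the transposition and directions by `rev`
    refine Fintype.sum_equiv (PolySite.transposeEquiv R) _ _ (fun y => ?_)
    show fermionEmbed (PolySite.transposeEmb R)
        (∑ i : Fin 2, ((w (ofLex y.1) i : ℝ) : ℂ) • clusterBondKinetic R y i) =
      ∑ i : Fin 2, (((fun x i => w (swapSite x) i.rev) (ofLex (PolySite.transposeEmb R y).1) i : ℝ) : ℂ) •
        clusterBondKinetic (transposeWindow R) (PolySite.transposeEmb R y) i
    rw [fermionEmbed_sum]
    refine Fintype.sum_equiv Fin.revPerm _ _ (fun i => ?_)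
    rw [Fin.revPerm_apply, fermionEmbed_smul, fermionEmbed_transposeEmb_clusterBondKinetic]
    simp only [PolySite.ofLex_coe_transposeEmb, swapSite_swapSite, Fin.rev_rev]
  · -- on-site part: reindex sites
    refine Fintype.sum_equiv (PolySite.transposeEquiv R) _ _ (fun y => ?_)
    show fermionEmbed (PolySite.transposeEmb R) (((v (ofLex y.1) : ℝ) : ℂ) •
        ((2 : ℂ) • (numberOp y 0 * numberOp y 1) - (numberOp y 0 + numberOp y 1) + (1 : FermionOp R))) =
      (((fun x => v (swapSite x)) (ofLex (PolySite.transposeEmb R y).1) : ℝ) : ℂ) •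
        ((2 : ℂ) • (numberOp (PolySite.transposeEmb R y) 0 * numberOp (PolySite.transposeEmb R y) 1) -
          (numberOp (PolySite.transposeEmb R y) 0 + numberOp (PolySite.transposeEmb R y) 1) +
          (1 : FermionOp (transposeWindow R)))
    rw [fermionEmbed_smul, fermionEmbed_add, fermionEmbed_sub, fermionEmbed_smul, fermionEmbed_mul,
      fermionEmbed_add, fermionEmbed_numberOp, fermionEmbed_numberOp, fermionEmbed_one]
    simp only [PolySite.ofLex_coe_transposeEmb, swapSite_swapSite]

/-- **A floor for a cluster is a floor for its transpose.**
[cite: ValentiStolzeHirschfeld1991, §II] -/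
theorem posSemidef_andersonCluster_transpose {R : Finset (Site 2)} {t U : ℝ} {w : Site 2 → Fin 2 → ℝ}
    {v : Site 2 → ℝ} {q : ℝ} (hq : (andersonCluster R t U w v - (q : ℂ) • (1 : FermionOp R)).PosSemidef) :
    (andersonCluster (transposeWindow R) t U (fun x i => w (swapSite x) i.rev) (fun x => v (swapSite x)) -
      (q : ℂ) • (1 : FermionOp (transposeWindow R))).PosSemidef := by
  have h := posSemidef_fermionEmbed_sub_smul_one (PolySite.transposeEmb R) hq
  rwa [fermionEmbed_transposeEmb_andersonCluster] at h

/-- Bond weights of direction `i` of the transpose are those of direction `rev i`. [folklore] -/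
private theorem bondWeightSum_transpose (R : Finset (Site 2)) (w : Site 2 → Fin 2 → ℝ) (i : Fin 2) :
    bondWeightSum (transposeWindow R) (fun x i => w (swapSite x) i.rev) i = bondWeightSum R w i.rev := by
  rw [bondWeightSum, bondWeightSum, transposeWindow, Finset.sum_map]
  refine Finset.sum_congr rfl fun x _ => ?_
  simp only [bondWeight, Function.Embedding.coeFn_mk, swapSite_swapSite]
  have hiff : swapSite x + unitVec i ∈ Finset.map ⟨swapSite, swapSite_injective⟩ R ↔ x + unitVec i.rev ∈ R := by
    rw [← transposeWindow, mem_transposeWindow, swapSite_add, swapSite_swapSite, swapSite_unitVec]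
  by_cases h : x + unitVec i.rev ∈ R
  · rw [if_pos (hiff.2 h), if_pos h]
  · rw [if_neg (fun h' => h (hiff.1 h')), if_neg h]

/-- Site weights are unchanged by transposition. [folklore] -/
private theorem siteWeightSum_transpose (R : Finset (Site 2)) (v : Site 2 → ℝ) :
    siteWeightSum (transposeWindow R) (fun x => v (swapSite x)) = siteWeightSum R v := by
  rw [siteWeightSum, siteWeightSum, transposeWindow, Finset.sum_map]
  refine Finset.sum_congr rfl fun x _ => ?_
  simp

open ThermodynamicLimit

/-- **Soundness of the square-lattice rows `rect<a>x<b>rot` from ONE certificate** (general density):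
a weighted open cluster `R ⊆ ℤ²` with TOTAL bond weight `Σ_{∥e₀} w + Σ_{∥e₁} w = 2`, `Σ v = 1` and a
certified floor `h(R; w, v) ⪰ q` gives, using `R` and its transpose `Rᵀ` (same floor by
`posSemidef_andersonCluster_transpose`), `q - (U/2)(1 - n) ≤ e(t,U,n)` for `0 ≤ n < 2`, `U ≥ 0`.
Row dictionary: `t = 1`, `n = 1`, bond weights `W_rational` in the tool's bond order, `q = bound_exact`.
[cite: Anderson1951, eq. (2)] -/
theorem energyDensity2D_ge_of_andersonCluster_transposePair (t : ℝ) {U : ℝ} (hU : 0 ≤ U) {n : ℝ}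
    (hn0 : 0 ≤ n) (hn2 : n < 2) (R : Finset (Site 2)) (w : Site 2 → Fin 2 → ℝ) (v : Site 2 → ℝ) {q : ℝ}
    (hw : bondWeightSum R w 0 + bondWeightSum R w 1 = 2) (hv : siteWeightSum R v = 1)
    (hq : (andersonCluster R t U w v - (q : ℂ) • (1 : FermionOp R)).PosSemidef) :
    q - U / 2 * (1 - n) ≤ energyDensity2D t U n := by
  have h := energyDensity2D_ge_of_andersonCluster_pair t hU hn0 hn2 R (transposeWindow R) w
    (fun x i => w (swapSite x) i.rev) v (fun x => v (swapSite x))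
    (fun i => by
      rw [bondWeightSum_transpose]
      fin_cases i
      · simpa using hw
      · simpa [add_comm] using hw)
    (by rw [siteWeightSum_transpose]; linarith) hq (posSemidef_andersonCluster_transpose hq)
  linarith

/-- Half filling: `q ≤ e(t,U,1)`. [cite: Anderson1951, eq. (2)] -/
theorem energyDensity2D_one_ge_of_andersonCluster_transposePair (t : ℝ) {U : ℝ} (hU : 0 ≤ U)
    (R : Finset (Site 2)) (w : Site 2 → Fin 2 → ℝ) (v : Site 2 → ℝ) {q : ℝ}
    (hw : bondWeightSum R w 0 + bondWeightSum R w 1 = 2) (hv : siteWeightSum R v = 1)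
    (hq : (andersonCluster R t U w v - (q : ℂ) • (1 : FermionOp R)).PosSemidef) :
    q ≤ energyDensity2D t U 1 := by
  have h := energyDensity2D_ge_of_andersonCluster_transposePair t hU zero_le_one one_lt_two R w v hw hv hq
  simpa using h

variable {L : ℕ} [NeZero L]

/-- **The same on a finite square torus at half filling** (`N = L²`, `L ≥ max 3 ℓ`, `R ⊆ [0,ℓ)²`):
`L² q ≤ E₀(H_{(ℤ/Lℤ)²}, L²)` — e.g. `16 q ≤ E₀(4×4; N = 16)` from a `2×4` cluster (`ℓ = 4`).
[cite: Anderson1951, eq. (2)] -/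
theorem groundEnergyAt_torus2_halfFilling_ge_of_andersonCluster_transposePair (t U : ℝ)
    {R : Finset (Site 2)} {ℓ : ℕ} (hR : R ⊆ halfOpenBox 2 ℓ) (hL : max 3 ℓ ≤ L)
    (w : Site 2 → Fin 2 → ℝ) (v : Site 2 → ℝ) {q : ℝ}
    (hw : bondWeightSum R w 0 + bondWeightSum R w 1 = 2) (hv : siteWeightSum R v = 1)
    (hq : (andersonCluster R t U w v - (q : ℂ) • (1 : FermionOp R)).PosSemidef) :
    (L : ℝ) ^ 2 * q ≤ groundEnergyAt (fermionTorusGraph 2 L) t U (L ^ 2) := by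
  have hR' : transposeWindow R ⊆ halfOpenBox 2 ℓ := fun z hz => by
    have hx := mem_halfOpenBox.1 (hR (mem_transposeWindow.1 hz))
    exact mem_halfOpenBox.2 fun i => by simpa using hx i.rev
  have h := groundEnergyAt_torus2_halfFilling_ge_of_andersonCluster_pair t U hR hR' hL w
    (fun x i => w (swapSite x) i.rev) v (fun x => v (swapSite x))
    (fun i => by
      rw [bondWeightSum_transpose]
      fin_cases i
      · simpa using hw
      · simpa [add_comm] using hw)
    (by rw [siteWeightSum_transpose]; linarith) hq (posSemidef_andersonCluster_transpose hq)
  simpa using h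

end Transpose

/-! ### §9. The square-lattice rows in coordinates: open rectangles `[0,a) × [0,b) ⊆ ℤ²` -/

section RectCoordinates

/-- A tail-truncated range sum: `Σ_{k<b} [k+1<b] f k = Σ_{k<b-1} f k`. [folklore] -/
private theorem sum_range_ite_succ_lt (b : ℕ) (f : ℕ → ℝ) :
    ∑ k ∈ Finset.range b, (if k + 1 < b then f k else 0) = ∑ k ∈ Finset.range (b - 1), f k := by
  cases b with
  | zero => simp
  | succ n =>
    rw [Finset.sum_range_succ, if_neg (by omega), add_zero, Nat.add_sub_cancel]
    exact Finset.sum_congr rfl fun j hj => by rw [if_pos (by have := Finset.mem_range.1 hj; omega)]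

/-- **The open rectangle** `[0,a) × [0,b) ⊆ ℤ²` (first coordinate `x 0 ∈ [0,a)` = column, second
`x 1 ∈ [0,b)` = row). [folklore] -/
def rectWindow (a b : ℕ) : Finset (Site 2) :=
  (halfOpenBox 2 (a + b)).filter fun x => x 0 < a ∧ x 1 < b

/-- Membership in the open rectangle. [folklore] -/
private theorem mem_rectWindow {a b : ℕ} {x : Site 2} :
    x ∈ rectWindow a b ↔ (0 ≤ x 0 ∧ x 0 < a) ∧ (0 ≤ x 1 ∧ x 1 < b) := by
  rw [rectWindow, Finset.mem_filter, mem_halfOpenBox, Fin.forall_fin_two]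
  push_cast
  constructor
  · rintro ⟨⟨h0, h1⟩, ha, hb⟩
    exact ⟨⟨h0.1, ha⟩, ⟨h1.1, hb⟩⟩
  · rintro ⟨⟨h0, ha⟩, ⟨h1, hb⟩⟩
    exact ⟨⟨⟨h0, by omega⟩, ⟨h1, by omega⟩⟩, ha, hb⟩

/-- The rectangle sits in the box `[0,ℓ)²` for `ℓ ≥ a, b`. [folklore] -/
private theorem rectWindow_subset_halfOpenBox {a b ℓ : ℕ} (ha : a ≤ ℓ) (hb : b ≤ ℓ) :
    rectWindow a b ⊆ halfOpenBox 2 ℓ := fun x hx => by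
  have h := mem_rectWindow.1 hx
  exact mem_halfOpenBox.2 (Fin.forall_fin_two.2 ⟨⟨h.1.1, by omega⟩, ⟨h.2.1, by omega⟩⟩)

/-- Bond weights of a rectangle cluster from a table: the bond from `(c, r)` in direction `i`
(`i = 0`: to `(c+1, r)`; `i = 1`: to `(c, r+1)`) carries `w c r i`. [folklore] -/
def rectBondWeights (w : ℕ → ℕ → Fin 2 → ℝ) : Site 2 → Fin 2 → ℝ :=
  fun x i => w (x 0).toNat (x 1).toNat i

/-- Site weights of a rectangle cluster from a table: the site `(c, r)` carries `v c r`. [folklore] -/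
def rectSiteWeights (v : ℕ → ℕ → ℝ) : Site 2 → ℝ := fun x => v (x 0).toNat (x 1).toNat

/-- The site `(c, r) ∈ ℤ²`. [folklore] -/
def mkSite2 (c r : ℕ) : Site 2 := ![(c : ℤ), (r : ℤ)]

/-- First coordinate of `mkSite2`. [folklore] -/
@[simp] private theorem mkSite2_zero (c r : ℕ) : mkSite2 c r 0 = c := rfl

/-- Second coordinate of `mkSite2`. [folklore] -/
@[simp] private theorem mkSite2_one (c r : ℕ) : mkSite2 c r 1 = r := rfl

/-- Sums over the rectangle are double range sums. [folklore] -/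
private theorem sum_rectWindow_eq (a b : ℕ) (f : Site 2 → ℝ) :
    ∑ x ∈ rectWindow a b, f x =
      ∑ c ∈ Finset.range a, ∑ r ∈ Finset.range b, f (mkSite2 c r) := by
  rw [← Finset.sum_product']
  refine Finset.sum_nbij' (fun x => ((x 0).toNat, (x 1).toNat)) (fun p => mkSite2 p.1 p.2) ?_ ?_ ?_ ?_ ?_
  · intro x hx
    have h := mem_rectWindow.1 (Finset.mem_coe.1 hx)
    exact Finset.mem_coe.2 (Finset.mem_product.2 ⟨Finset.mem_range.2 (by omega), Finset.mem_range.2 (by omega)⟩)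
  · intro p hp
    have h := Finset.mem_product.1 (Finset.mem_coe.1 hp)
    have h1 := Finset.mem_range.1 h.1
    have h2 := Finset.mem_range.1 h.2
    exact Finset.mem_coe.2 (mem_rectWindow.2
      ⟨⟨by simp, by simp; exact_mod_cast h1⟩, ⟨by simp, by simp; exact_mod_cast h2⟩⟩)
  · intro x hx
    have h := mem_rectWindow.1 (Finset.mem_coe.1 hx)
    funext i
    fin_cases i
    · show (((x 0).toNat : ℕ) : ℤ) = x 0
      exact Int.toNat_of_nonneg h.1.1
    · show (((x 1).toNat : ℕ) : ℤ) = x 1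
      exact Int.toNat_of_nonneg h.2.1
  · intro p _
    simp
  · intro x hx
    have h := mem_rectWindow.1 (Finset.mem_coe.1 hx)
    show f x = f (mkSite2 (x 0).toNat (x 1).toNat)
    congr 1
    funext i
    fin_cases i
    · show x 0 = (((x 0).toNat : ℕ) : ℤ)
      exact (Int.toNat_of_nonneg h.1.1).symm
    · show x 1 = (((x 1).toNat : ℕ) : ℤ)
      exact (Int.toNat_of_nonneg h.2.1).symm

/-- `Σ_{x ∈ [0,a)×[0,b)} v = Σ_{c<a} Σ_{r<b} v c r`. [folklore] -/
private theorem siteWeightSum_rect (a b : ℕ) (v : ℕ → ℕ → ℝ) :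
    siteWeightSum (rectWindow a b) (rectSiteWeights v) =
      ∑ c ∈ Finset.range a, ∑ r ∈ Finset.range b, v c r := by
  rw [siteWeightSum, sum_rectWindow_eq]
  refine Finset.sum_congr rfl fun c _ => Finset.sum_congr rfl fun r _ => ?_
  simp [rectSiteWeights]

/-- Horizontal bond weights: `Σ_{c<a-1} Σ_{r<b} w c r 0`. [folklore] -/
private theorem bondWeightSum_rect_zero (a b : ℕ) (w : ℕ → ℕ → Fin 2 → ℝ) :
    bondWeightSum (rectWindow a b) (rectBondWeights w) 0 =
      ∑ c ∈ Finset.range (a - 1), ∑ r ∈ Finset.range b, w c r 0 := by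
  rw [bondWeightSum, sum_rectWindow_eq]
  have h1 : ∀ c ∈ Finset.range a, ∀ r ∈ Finset.range b,
      bondWeight (rectWindow a b) (rectBondWeights w) (mkSite2 c r) 0 = if c + 1 < a then w c r 0 else 0 := by
    intro c hc r hr
    have hc' := Finset.mem_range.1 hc
    have hr' := Finset.mem_range.1 hr
    have hiff : mkSite2 c r + unitVec 0 ∈ rectWindow a b ↔ c + 1 < a := by
      rw [mem_rectWindow]
      simp only [Pi.add_apply, unitVec, Pi.single_eq_same, Pi.single_eq_of_ne (one_ne_zero (α := Fin 2)),
        mkSite2_zero, mkSite2_one, add_zero]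
      omega
    simp only [bondWeight, rectBondWeights, mkSite2_zero, mkSite2_one, Int.toNat_natCast]
    by_cases h : c + 1 < a
    · rw [if_pos (hiff.2 h), if_pos h]
    · rw [if_neg (fun h' => h (hiff.1 h')), if_neg h]
  rw [Finset.sum_congr rfl fun c hc => Finset.sum_congr rfl fun r hr => h1 c hc r hr]
  -- swap the sums, truncate the `c`-range, swap back
  rw [Finset.sum_comm, ← sum_range_ite_succ_lt a (fun c => ∑ r ∈ Finset.range b, w c r 0), Finset.sum_comm]
  refine Finset.sum_congr rfl fun c _ => ?_
  split_ifs <;> simp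

/-- Vertical bond weights: `Σ_{c<a} Σ_{r<b-1} w c r 1`. [folklore] -/
private theorem bondWeightSum_rect_one (a b : ℕ) (w : ℕ → ℕ → Fin 2 → ℝ) :
    bondWeightSum (rectWindow a b) (rectBondWeights w) 1 =
      ∑ c ∈ Finset.range a, ∑ r ∈ Finset.range (b - 1), w c r 1 := by
  rw [bondWeightSum, sum_rectWindow_eq]
  refine Finset.sum_congr rfl fun c hc => ?_
  have hc' := Finset.mem_range.1 hc
  rw [← sum_range_ite_succ_lt b (fun r => w c r 1)]
  refine Finset.sum_congr rfl fun r hr => ?_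
  have hr' := Finset.mem_range.1 hr
  have hiff : mkSite2 c r + unitVec 1 ∈ rectWindow a b ↔ r + 1 < b := by
    rw [mem_rectWindow]
    simp only [Pi.add_apply, unitVec, Pi.single_eq_same, Pi.single_eq_of_ne (zero_ne_one (α := Fin 2)),
      mkSite2_zero, mkSite2_one, add_zero]
    omega
  simp only [bondWeight, rectBondWeights, mkSite2_zero, mkSite2_one, Int.toNat_natCast]
  by_cases h : r + 1 < b
  · rw [if_pos (hiff.2 h), if_pos h]
  · rw [if_neg (fun h' => h (hiff.1 h')), if_neg h]

open ThermodynamicLimit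

/-- **Soundness of `rect<b>x<a>rot` rows in coordinates (thermodynamic limit, density `n`).** An open
`a × b` rectangle (`a` columns `c`, `b` rows `r`; tool: `Lx = a`, `Ly = b`, site `p = r·Lx + c`, bond
`(p,p+1)` ↔ `w c r 0`, bond `(p,p+Lx)` ↔ `w c r 1`, site weight ↔ `v c r`) with TOTAL bond weight `2`,
site weights summing to `1` and ONE certified floor `h(w,v) ⪰ q` gives `q - (U/2)(1-n) ≤ e(t,U,n)`
(`0 ≤ n < 2`, `U ≥ 0`); at half filling `q ≤ e(t,U,1)`. [cite: Anderson1951, eq. (2)] -/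
theorem energyDensity2D_ge_of_andersonRect (t : ℝ) {U : ℝ} (hU : 0 ≤ U) {n : ℝ} (hn0 : 0 ≤ n)
    (hn2 : n < 2) (a b : ℕ) (w : ℕ → ℕ → Fin 2 → ℝ) (v : ℕ → ℕ → ℝ) {q : ℝ}
    (hw : (∑ c ∈ Finset.range (a - 1), ∑ r ∈ Finset.range b, w c r 0) +
      (∑ c ∈ Finset.range a, ∑ r ∈ Finset.range (b - 1), w c r 1) = 2)
    (hv : ∑ c ∈ Finset.range a, ∑ r ∈ Finset.range b, v c r = 1)
    (hq : (andersonCluster (rectWindow a b) t U (rectBondWeights w) (rectSiteWeights v) -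
      (q : ℂ) • (1 : FermionOp (rectWindow a b))).PosSemidef) :
    q - U / 2 * (1 - n) ≤ energyDensity2D t U n :=
  energyDensity2D_ge_of_andersonCluster_transposePair t hU hn0 hn2 _ _ _
    (by rw [bondWeightSum_rect_zero, bondWeightSum_rect_one]; exact hw)
    (by rw [siteWeightSum_rect]; exact hv) hq

/-- Half filling: `q ≤ e(t,U,1)`. [cite: Anderson1951, eq. (2)] -/
theorem energyDensity2D_one_ge_of_andersonRect (t : ℝ) {U : ℝ} (hU : 0 ≤ U) (a b : ℕ)
    (w : ℕ → ℕ → Fin 2 → ℝ) (v : ℕ → ℕ → ℝ) {q : ℝ}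
    (hw : (∑ c ∈ Finset.range (a - 1), ∑ r ∈ Finset.range b, w c r 0) +
      (∑ c ∈ Finset.range a, ∑ r ∈ Finset.range (b - 1), w c r 1) = 2)
    (hv : ∑ c ∈ Finset.range a, ∑ r ∈ Finset.range b, v c r = 1)
    (hq : (andersonCluster (rectWindow a b) t U (rectBondWeights w) (rectSiteWeights v) -
      (q : ℂ) • (1 : FermionOp (rectWindow a b))).PosSemidef) :
    q ≤ energyDensity2D t U 1 := by
  have h := energyDensity2D_ge_of_andersonRect t hU zero_le_one one_lt_two a b w v hw hv hq
  simpa using h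

variable {L : ℕ} [NeZero L]

/-- **The same on a finite square torus at half filling**: `L² q ≤ E₀(H_{(ℤ/Lℤ)²}, L²)` for every
`L ≥ max 3 (max a b)` — e.g. `16 q ≤ E₀(4 × 4; N = 16)` from the `2 × 4` rows. [cite: Anderson1951, eq. (2)] -/
theorem groundEnergyAt_torus2_halfFilling_ge_of_andersonRect (t U : ℝ) (a b : ℕ)
    (hL : max 3 (max a b) ≤ L) (w : ℕ → ℕ → Fin 2 → ℝ) (v : ℕ → ℕ → ℝ) {q : ℝ}
    (hw : (∑ c ∈ Finset.range (a - 1), ∑ r ∈ Finset.range b, w c r 0) +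
      (∑ c ∈ Finset.range a, ∑ r ∈ Finset.range (b - 1), w c r 1) = 2)
    (hv : ∑ c ∈ Finset.range a, ∑ r ∈ Finset.range b, v c r = 1)
    (hq : (andersonCluster (rectWindow a b) t U (rectBondWeights w) (rectSiteWeights v) -
      (q : ℂ) • (1 : FermionOp (rectWindow a b))).PosSemidef) :
    (L : ℝ) ^ 2 * q ≤ groundEnergyAt (fermionTorusGraph 2 L) t U (L ^ 2) :=
  groundEnergyAt_torus2_halfFilling_ge_of_andersonCluster_transposePair t U
    (rectWindow_subset_halfOpenBox (le_max_left a b) (le_max_right a b)) hL _ _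
    (by rw [bondWeightSum_rect_zero, bondWeightSum_rect_one]; exact hw)
    (by rw [siteWeightSum_rect]; exact hv) hq

end RectCoordinates


end Literature.MathematicalPhysics.QuantumLattice.AndersonCluster

end
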